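import Mathlib
import Literature.MathematicalPhysics.QuantumFieldTheory.Balaban1983to89.Beta.VectorTailsLoc

/-!
# (W3a)₀ vector road, node VECTOR-TAILS-PROP12 — the DIPOLE parametrix: differences of the
# covariant propagator `𝒢 = Δ_a⁻¹` in the SOURCE bond, per base point

Companion of `Beta/VectorTails.lean` (Newton parametrix `χ·G₀`), `Beta/VectorTailsCov.lean`
(`Δ_a = Lap + V`, entry identity for `𝒢 = B5Prop11Plancherel.calG = (B5DeltaA169.DeltaA)⁻¹` at
`U = 1`) and `Beta/VectorTailsLoc.lean` (the per-base-point value leg `d0` and observation-variable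
difference leg `d1`, uniform in the volume, modulo `B5.Prop12Printed` + `B5.Kernel126_127Printed`
BY NAME).  The consumer socket `Beta/SquareTableAvgFirst.oneLoopDrift_of_scalarBounds_avgFirst`
also asks, per base point `b = (x₀, ν₀)`, for the DIAGONAL difference
`d1× : 𝒢(b+e_μ+v, b+e_μ) − 𝒢(b+v, b)` and the MIXED cross-base-point second difference
`d2× : ∇_{x,ν}∇_{x₀,μ} 𝒢`.  Both contain a difference in the SOURCE bond `x₀ ↦ x₀ + e_μ`, which the
point parametrix does not expose with the right power: differencing the translated residuals
`ρ_{x₀+e_μ} − ρ_{x₀}` costs a THIRD difference of the `C¹` cutoff `χ` (only `O(m⁻²)` on its knot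
shells), i.e. one power of `max(1,|v|)` short.

## What this file does (all `[folklore]`, kernel-checked, no new cited facts)

THE DIPOLE PARAMETRIX.  Take the difference on the SMOOTH factor instead of on the cutoff:
`H̃_{x₀,μ}(x) = χ_{x₀}(x) · u_μ(x − x₀)`, `u_μ(v) = G₀(v − e_μ) − G₀(v)` (§1 `dker`, `dpar`;
torus transport §2 `dparT`).  Since `Δu_μ = −δ_{e_μ} + δ_0` (`lap_dker`) and `χ_{x₀} = 1` at both
poles (`m ≥ 1`), `Δ H̃ = −δ_{x₀+e_μ} + δ_{x₀} + ρ̃` (`lap_dpar`, `lapT_dparT`) with the residual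
`ρ̃ = cres` made of FIRST and SECOND differences of `χ` only (`PoissonInterior.cutoff_diff_le`,
`cutoff_diff2_le`) against `u_μ`, `∇u_μ` — and `u_μ` is one power better than `G₀`:
`|u_μ| ≤ U₀/nrm^{d−1}`, `|∇^± u_μ| ≤ U₁/nrm^d` (`dker_bounds`, from `G₀_diff_bound`,
`G₀_diff2_bound`).  Hence (constants BEFORE the volume and the centre, §2b):
`|H̃| ≤ D₀/nrm^{d−1}` (`abs_dparT_le`), `|∇_x H̃| ≤ D₁/nrm^d` in the interior
(`abs_dparT_diff_le`), `|ρ̃| ≤ Dρ/m^{d+1}` (`abs_dresT_le`), `Σ|H̃| ≤ D m` (`sum_abs_dparT_le`) —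
each ONE POWER better than the point parametrix (`m^{-d}`, `m²`).  §1 is written for a general
kernel `u` with `|u| ≤ U₀/nrm^p`, `|∇u| ≤ U₁/nrm^{p+1}` (`cpar`, `cres`, `lap_cpar`, `abs_cres_le`,
`abs_cpar_diff_le`, `sum_abs_cpar_le`), so that `VectorTails.param = cpar · G₀` is the case
`p = d − 2` and the dipole is `p = d − 1`.

THE DIPOLE IDENTITIES (§3).  For a left inverse `G` of `Δ = Lc + V` and `Lc h = c(δ_{x₁} − δ_{x₀}
− ρ)`: `G x x₁ − G x x₀ = (Gρ)(x) + c⁻¹(h(x) − (G V h)(x))` (`entry_diff_eq_of_parametrix`), and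
its `∂_{x,μ'}` version for `VectorTailsLoc.shiftDiff` (`shiftDiff_entry_diff_eq`); realised for
`𝒢` with `Lc = Lap = ⊕ n²(−Δ₁)`, `c = n²` (`Lap_colOf_of_pointwise₂`,
`calG_entry_diff_eq[_of_pointwise]`, `shiftDiff_calG_entry_diff_eq[_of_pointwise]`):
`𝒢(i,(x₀+e_μ,ν₀)) − 𝒢(i,(x₀,ν₀)) = (𝒢 colDres)(i) + n⁻²(colDpar(i) − (𝒢(V colDpar))(i))`.

THE BOUNDS PER BASE POINT (§4–§6), modulo `B5.Prop12Printed fam` [B5, (1.110)–(1.114)] and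
`B5.Kernel126_127Printed K` [B5, (1.126)–(1.127)] BY NAME (hypotheses, never discharged).  §4:
envelopes of a GENERAL column of fine support radius `3m` / `3m−1` (`col_envelope`,
`aQQ_col_envelope`, `dPd_col_envelope` — `VectorTailsLoc.resid_envelope` / `aQQ_envelope` /
`dPd_envelope` with the pointwise / `ℓ¹` sizes abstracted) and `dipole_consts_le` (the remainder
constants are `≤ B η^{d+1}` for `1 ≤ m ≤ n ≤ R m`).  §5: `entry_srcDiff_bound` — for `d ≥ 3`,
`R ≥ 1`, `δ > 0`, `A ≥ 0` chosen BEFORE the instance,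
`|𝒢((x,κ),(x₀+e_μ,ν₀)) − 𝒢((x,κ),(x₀,ν₀))| ≤ A η² e^{-(δ/n)‖v‖_∞}/max(1,‖v‖_∞)^{d−1}`
(`VectorTailsLoc.norm_le_of_identity` on `calG_entry_diff_eq`, (1.110) constant `C`,
`remainder_profile (d := d+1)`), and `entry_mixed_bound` —
`|[𝒢((x+e_{μ'},κ),·) − 𝒢((x,κ),·)](x₀+e_μ,ν₀) − [same](x₀,ν₀)|`
`  ≤ A η² e^{-(δ/n)‖v‖_∞}/max(1,‖v‖_∞)^d`
(`shiftDiff_calG_entry_diff_eq`, `locBound_shiftDiff` constant `C η`, `abs_dparT_diff_le`,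
`remainder_profile (d := d+2)`), both for `1 ≤ m ≤ n ≤ R m`, `6m+6 ≤ n M_μ`.  §6: the bounded
case `n ≤ N₀` from (1.110) alone (`entry_srcDiff_bound_small`, `entry_mixed_bound_small`:
triangle inequality on the two point sources, `exp_block_shift_le`) and the packaging
`legs_uniform₂` — ONE rate `δ`, constants `A₂, A₃`, EVERY instance, no side condition
(`m = ⌊(n−6)/6⌋`, `R = 12` for `n ≥ 24`; `N₀ = 23`).  With `VectorTailsLoc.legs_uniform`
(`d0`: `/nrm^{d−2}`, `d1`: `/nrm^{d−1}`) these are, at `d = 4`, the four decay shapes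
`|v|^{-2}, |v|^{-3}, |v|^{-3}, |v|^{-4}` (times `η² e^{-(δ/n)|v|}`) of the rows `d0, d1, d1×, d2×`
of the consumer's table, for the torus-intrinsic separation `‖v‖_∞ = tdist x₀ x`; the adapter
to the consumer's exact binders (which base point carries which shift, `v + e_μ` offsets) is
bookkeeping on the consumer side and is NOT done here.

## What it does NOT do (honest scope)

* No adapter to `Beta/SquareTableAvgFirst.oneLoopDrift_of_scalarBounds_avgFirst`'s literal rows
  (`Gf n b v`, `sh n b`, `supNorm v`): the four profiles are stated for `calG` entries indexed by
  bonds of the fine torus; the consumer's `h0` row (comparison with the free massless propagator)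
  is a different statement and is not addressed by this lineage.
* No PURE second difference `∇²_x 𝒢(x, x₀)` per base point (beta-ref R-g31-1 (a): not reachable
  from the printed displays (1.110)–(1.114), which control `|Δ G J|` and Hölder quotients only).
* Nothing here discharges `B5.Prop12Printed` / `B5.Kernel126_127Printed`; no continuum limit, no
  Clay statement: closing `BetaPertH` makes Bałaban's UV stability unconditional, nothing more.
-/

open Finset Matrix
open scoped BigOperators ComplexConjugate Matrix
open Literature.Probability.LatticeModels (latticeLaplacianZd latticeLaplacianZd_def)

namespace Literature.MathematicalPhysics.QuantumFieldTheory.Balaban1983to89.Beta.VectorTailsDipole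

open Literature.MathematicalPhysics.QuantumFieldTheory.Balaban1983to89.B5Prop11Plancherel
open Literature.MathematicalPhysics.QuantumFieldTheory.Balaban1983to89.B5Prop11Lower
open Literature.MathematicalPhysics.QuantumFieldTheory.Balaban1983to89.B5Action121
open Literature.MathematicalPhysics.QuantumFieldTheory.Balaban1983to89.B5Block118
open Literature.MathematicalPhysics.QuantumFieldTheory.Balaban1983to89.B5Value126
open Literature.MathematicalPhysics.QuantumFieldTheory.Balaban1983to89.B5DeltaA169
open Literature.MathematicalPhysics.QuantumFieldTheory.Balaban1983to89.Beta.VectorTails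
open Literature.MathematicalPhysics.QuantumFieldTheory.Balaban1983to89.Beta.VectorTailsCov
open Literature.MathematicalPhysics.QuantumFieldTheory.Balaban1983to89.Beta.VectorTailsLoc
open Literature.MathematicalPhysics.QuantumFieldTheory.Balaban1983to89.Beta.PoissonInterior

/-! ## §1 The cutoff parametrix of a general kernel on `ℤ^d`, and the dipole kernel -/

section Generic

variable {d : ℕ}

/-- the CUTOFF PARAMETRIX of a kernel `u` centred at `x'`: `cpar m x' u y = χ_{x'}(y) · u(y − x')`
(`χ = PoissonInterior.cutoff m x'`; `VectorTails.param m x' = cpar m x' G₀`). [folklore] -/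
noncomputable def cpar (m : ℕ) (x' : Fin d → ℤ) (u : (Fin d → ℤ) → ℝ) (y : Fin d → ℤ) : ℝ :=
  cutoff m x' y * u (y - x')

/-- its RESIDUAL (the cross terms of the discrete product rule):
`cres m x' u y = Σ_i [(χ(y+e_i) − χ(y)) u(y+e_i−x') + (χ(y−e_i) − χ(y)) u(y−e_i−x')]`. [folklore] -/
noncomputable def cres (m : ℕ) (x' : Fin d → ℤ) (u : (Fin d → ℤ) → ℝ) (y : Fin d → ℤ) : ℝ :=
  ∑ i : Fin d, ((cutoff m x' (y + Pi.single i 1) - cutoff m x' y) * u (y + Pi.single i 1 - x') +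
    (cutoff m x' (y - Pi.single i 1) - cutoff m x' y) * u (y - Pi.single i 1 - x'))

/-- **the cutoff-parametrix equation** `Δ (χ u(· − x')) = χ · (Δu)(· − x') + cres`. [folklore] -/
theorem lap_cpar (m : ℕ) (x' : Fin d → ℤ) (u : (Fin d → ℤ) → ℝ) (y : Fin d → ℤ) :
    latticeLaplacianZd (cpar m x' u) y =
      cutoff m x' y * latticeLaplacianZd u (y - x') + cres m x' u y := by
  have hp : cpar m x' u = fun z => cutoff m x' z * u (z - x') := rfl
  rw [hp, lap_mul (cutoff m x') (fun z => u (z - x')) y, lap_translate]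
  rfl

/-- the Laplacian of a difference. [folklore] -/
theorem lap_sub (f g : (Fin d → ℤ) → ℝ) (x : Fin d → ℤ) :
    latticeLaplacianZd (fun z => f z - g z) x =
      latticeLaplacianZd f x - latticeLaplacianZd g x := by
  rw [latticeLaplacianZd_def, latticeLaplacianZd_def, latticeLaplacianZd_def]
  simp only [Finset.sum_add_distrib, Finset.sum_sub_distrib]
  ring

/-- the cutoff parametrix is supported in `cube x' (3m − 1)`. [folklore] -/
theorem cpar_eq_zero_of_not_mem {m : ℕ} (hm : 1 ≤ m) (u : (Fin d → ℤ) → ℝ) {x' y : Fin d → ℤ}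
    (h : y ∉ cube x' (3 * m - 1)) : cpar m x' u y = 0 := by
  simp [cpar, cutoff_eq_zero_of_not_mem hm h]

/-- the residual vanishes on the inner cube `cube x' (m − 1)`. [folklore] -/
theorem cres_eq_zero_of_mem {m : ℕ} (u : (Fin d → ℤ) → ℝ) {x' y : Fin d → ℤ}
    (h : y ∈ cube x' (m - 1)) (hm : 1 ≤ m) : cres m x' u y = 0 := by
  have h' : ∀ j, |y j - x' j| + 1 ≤ (m : ℤ) := by
    intro j
    have := (mem_cube.mp h) j
    have e : ((m - 1 : ℕ) : ℤ) = m - 1 := by omega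
    rw [e] at this
    linarith
  refine Finset.sum_eq_zero fun i _ => ?_
  obtain ⟨h0, h1, h2⟩ := cutoff_shift_eq_one h' i
  rw [h0, h1, h2]; ring

/-- the residual is supported in `cube x' (3m)`. [folklore] -/
theorem cres_eq_zero_of_not_mem {m : ℕ} (hm : 1 ≤ m) (u : (Fin d → ℤ) → ℝ) {x' y : Fin d → ℤ}
    (h : y ∉ cube x' (3 * m)) : cres m x' u y = 0 := by
  have e3 : 3 * m - 1 + 1 = 3 * m := by omega
  have hy : y ∉ cube x' (3 * m - 1) := fun hy => h (cube_mono (by omega) hy)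
  have hplus : ∀ i : Fin d, y + Pi.single i 1 ∉ cube x' (3 * m - 1) := by
    intro i hi
    have := sub_mem_cube_succ hi (supNorm_single_one i)
    rw [add_sub_cancel_right, e3] at this
    exact h this
  have hminus : ∀ i : Fin d, y - Pi.single i 1 ∉ cube x' (3 * m - 1) := by
    intro i hi
    have := add_mem_cube_succ hi (supNorm_single_one i)
    rw [sub_add_cancel, e3] at this
    exact h this
  refine Finset.sum_eq_zero fun i _ => ?_
  rw [cutoff_eq_zero_of_not_mem hm hy, cutoff_eq_zero_of_not_mem hm (hplus i),
    cutoff_eq_zero_of_not_mem hm (hminus i)]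
  ring

/-- `|cpar| ≤ U₀ / nrm^p` from `|u| ≤ U₀ / nrm^p`. [folklore] -/
theorem abs_cpar_le {m : ℕ} (hm : 1 ≤ m) {u : (Fin d → ℤ) → ℝ} {U₀ : ℝ} {p : ℕ}
    (hu : ∀ v, |u v| ≤ U₀ / nrm v ^ p) (x' y : Fin d → ℤ) :
    |cpar m x' u y| ≤ U₀ / nrm (y - x') ^ p := by
  rw [cpar, abs_mul]
  have hU : 0 ≤ U₀ / nrm (y - x') ^ p := (abs_nonneg _).trans (hu _)
  calc |cutoff m x' y| * |u (y - x')| ≤ 1 * (U₀ / nrm (y - x') ^ p) :=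
        mul_le_mul (abs_cutoff_le_one hm x' y) (hu _) (abs_nonneg _) zero_le_one
    _ = _ := one_mul _

/-- **residual envelope** `|cres| ≤ C / m^{p+2}` from `|u| ≤ U₀/nrm^p`, `|∇u| ≤ U₁/nrm^{p+1}`
(the residual lives on the shell `m ≤ |y − x'| ≤ 3m`; same resummation as
`VectorTails.abs_resid_le`). [folklore] -/
theorem abs_cres_le {u : (Fin d → ℤ) → ℝ} {U₀ U₁ : ℝ} {p : ℕ} (hU₀ : 0 ≤ U₀) (hU₁ : 0 ≤ U₁)
    (hu0 : ∀ v, |u v| ≤ U₀ / nrm v ^ p)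
    (hu1 : ∀ (v : Fin d → ℤ) (i : Fin d), |u (v + Pi.single i 1) - u v| ≤ U₁ / nrm v ^ (p + 1) ∧
      |u (v - Pi.single i 1) - u v| ≤ U₁ / nrm v ^ (p + 1))
    {m : ℕ} (hm : 1 ≤ m) (x' y : Fin d → ℤ) :
    |cres m x' u y| ≤ d * (4 * (2 * U₁) * 2 ^ (p + 1) + 4 * U₀ * 2 ^ p) / (m : ℝ) ^ (p + 2) := by
  set A : ℝ := 4 * (2 * U₁) * 2 ^ (p + 1) + 4 * U₀ * 2 ^ p with hA
  have hA0 : 0 ≤ A := by positivity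
  have hmpos : (0 : ℝ) < m := by exact_mod_cast hm
  by_cases hy : y ∈ cube x' (m - 1)
  · rw [cres_eq_zero_of_mem u hy hm, abs_zero]; positivity
  have hsup : m ≤ supNorm (y - x') := le_supNorm_of_not_mem hy hm
  set v := y - x' with hv
  have hnv : (m : ℝ) / 2 ≤ nrm v := half_le_nrm hsup
  have term : ∀ i : Fin d,
      |(cutoff m x' (y + Pi.single i 1) - cutoff m x' y) * u (y + Pi.single i 1 - x') +
        (cutoff m x' (y - Pi.single i 1) - cutoff m x' y) * u (y - Pi.single i 1 - x')| ≤
      A / (m : ℝ) ^ (p + 2) := by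
    intro i
    set e : Fin d → ℤ := Pi.single i 1 with he
    have hpe : y + e - x' = v + e := by rw [hv]; abel
    have hme : y - e - x' = v - e := by rw [hv]; abel
    rw [hpe, hme]
    have alg : (cutoff m x' (y + e) - cutoff m x' y) * u (v + e) +
        (cutoff m x' (y - e) - cutoff m x' y) * u (v - e) =
        (cutoff m x' (y + e) - cutoff m x' y) * (u (v + e) - u (v - e)) +
        (cutoff m x' (y + e) - 2 * cutoff m x' y + cutoff m x' (y - e)) * u (v - e) := by ring
    rw [alg]
    have f1 : |cutoff m x' (y + e) - cutoff m x' y| ≤ 4 / m := (cutoff_diff_le hm x' y i).1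
    have f2 : |u (v + e) - u (v - e)| ≤ 2 * U₁ * (2 ^ (p + 1) / (m : ℝ) ^ (p + 1)) := by
      have hb := inv_nrm_pow_le hm (p := p + 1) hnv
      have g1 := (hu1 v i).1
      have g2 := (hu1 v i).2
      have : |u (v + e) - u (v - e)| ≤ |u (v + e) - u v| + |u (v - e) - u v| := by
        have := abs_sub_le (u (v + e)) (u v) (u (v - e))
        rwa [abs_sub_comm (u v) (u (v - e))] at this
      calc |u (v + e) - u (v - e)| ≤ U₁ / nrm v ^ (p + 1) + U₁ / nrm v ^ (p + 1) :=
            this.trans (add_le_add g1 g2)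
        _ = 2 * U₁ * (1 / nrm v ^ (p + 1)) := by ring
        _ ≤ 2 * U₁ * (2 ^ (p + 1) / (m : ℝ) ^ (p + 1)) :=
            mul_le_mul_of_nonneg_left hb (by positivity)
    have f3 : |cutoff m x' (y + e) - 2 * cutoff m x' y + cutoff m x' (y - e)| ≤ 4 / (m : ℝ) ^ 2 :=
      cutoff_diff2_le hm x' y i
    have f4 : |u (v - e)| ≤ U₀ * (2 ^ p / (m : ℝ) ^ p) := by
      have hnve : (m : ℝ) / 2 ≤ nrm (v - e) := by
        rw [sub_eq_add_neg]
        exact half_le_nrm_add hsup (by rw [supNorm_neg]; exact supNorm_single_one i)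
      have hb := inv_nrm_pow_le hm (p := p) hnve
      calc |u (v - e)| ≤ U₀ / nrm (v - e) ^ p := hu0 _
        _ = U₀ * (1 / nrm (v - e) ^ p) := by ring
        _ ≤ U₀ * (2 ^ p / (m : ℝ) ^ p) := mul_le_mul_of_nonneg_left hb hU₀
    have pw1 : (4 / (m : ℝ)) * (2 * U₁ * (2 ^ (p + 1) / (m : ℝ) ^ (p + 1))) =
        4 * (2 * U₁) * 2 ^ (p + 1) / (m : ℝ) ^ (p + 2) := by
      have : (m : ℝ) ^ (p + 2) = (m : ℝ) * (m : ℝ) ^ (p + 1) := by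
        rw [← pow_succ']
      rw [this]; field_simp
    have pw2 : (4 / (m : ℝ) ^ 2) * (U₀ * (2 ^ p / (m : ℝ) ^ p)) =
        4 * U₀ * 2 ^ p / (m : ℝ) ^ (p + 2) := by
      have : (m : ℝ) ^ (p + 2) = (m : ℝ) ^ 2 * (m : ℝ) ^ p := by
        rw [← pow_add]; congr 1; omega
      rw [this]; field_simp
    calc |(cutoff m x' (y + e) - cutoff m x' y) * (u (v + e) - u (v - e)) +
          (cutoff m x' (y + e) - 2 * cutoff m x' y + cutoff m x' (y - e)) * u (v - e)|
        ≤ |cutoff m x' (y + e) - cutoff m x' y| * |u (v + e) - u (v - e)| +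
          |cutoff m x' (y + e) - 2 * cutoff m x' y + cutoff m x' (y - e)| * |u (v - e)| := by
          rw [← abs_mul, ← abs_mul]; exact abs_add_le _ _
      _ ≤ (4 / (m : ℝ)) * (2 * U₁ * (2 ^ (p + 1) / (m : ℝ) ^ (p + 1))) +
          (4 / (m : ℝ) ^ 2) * (U₀ * (2 ^ p / (m : ℝ) ^ p)) := by
          exact add_le_add (mul_le_mul f1 f2 (abs_nonneg _) (by positivity))
            (mul_le_mul f3 f4 (abs_nonneg _) (by positivity))
      _ = A / (m : ℝ) ^ (p + 2) := by rw [pw1, pw2, hA]; ring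
  calc |cres m x' u y| ≤ ∑ i : Fin d,
        |(cutoff m x' (y + Pi.single i 1) - cutoff m x' y) * u (y + Pi.single i 1 - x') +
          (cutoff m x' (y - Pi.single i 1) - cutoff m x' y) * u (y - Pi.single i 1 - x')| :=
        Finset.abs_sum_le_sum_abs _ _
    _ ≤ ∑ _i : Fin d, A / (m : ℝ) ^ (p + 2) := Finset.sum_le_sum fun i _ => term i
    _ = d * A / (m : ℝ) ^ (p + 2) := by
        rw [Finset.sum_const, Finset.card_univ, Fintype.card_fin, nsmul_eq_mul]; ring

/-- **gradient envelope** `|cpar(y + e_i) − cpar(y)| ≤ (U₁ + 24 U₀)/nrm^{p+1}` (same product rule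
as `VectorTails.abs_param_diff_le`). [folklore] -/
theorem abs_cpar_diff_le {u : (Fin d → ℤ) → ℝ} {U₀ U₁ : ℝ} {p : ℕ} (hU₀ : 0 ≤ U₀)
    (hu0 : ∀ v, |u v| ≤ U₀ / nrm v ^ p)
    (hu1 : ∀ (v : Fin d → ℤ) (i : Fin d), |u (v + Pi.single i 1) - u v| ≤ U₁ / nrm v ^ (p + 1))
    {m : ℕ} (hm : 1 ≤ m) (x' y : Fin d → ℤ) (i : Fin d) :
    |cpar m x' u (y + Pi.single i 1) - cpar m x' u y| ≤
      (U₁ + 24 * U₀) / nrm (y - x') ^ (p + 1) := by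
  have hmpos : (0 : ℝ) < m := by exact_mod_cast hm
  set e : Fin d → ℤ := Pi.single i 1 with he
  set v := y - x' with hv
  have hpe : y + e - x' = v + e := by rw [hv]; abel
  have alg : cpar m x' u (y + e) - cpar m x' u y =
      cutoff m x' (y + e) * (u (v + e) - u v) + (cutoff m x' (y + e) - cutoff m x' y) * u v := by
    simp only [cpar]; rw [hpe]; ring
  rw [alg]
  have t1 : |cutoff m x' (y + e) * (u (v + e) - u v)| ≤ U₁ / nrm v ^ (p + 1) := by
    rw [abs_mul]
    have h0 : 0 ≤ U₁ / nrm v ^ (p + 1) := (abs_nonneg _).trans (hu1 v i)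
    calc |cutoff m x' (y + e)| * |u (v + e) - u v| ≤ 1 * (U₁ / nrm v ^ (p + 1)) :=
          mul_le_mul (abs_cutoff_le_one hm x' _) (hu1 v i) (abs_nonneg _) zero_le_one
      _ = _ := one_mul _
  have t2 : |(cutoff m x' (y + e) - cutoff m x' y) * u v| ≤ 24 * U₀ / nrm v ^ (p + 1) := by
    by_cases hfar : y ∉ cube x' (3 * m - 1) ∧ y + e ∉ cube x' (3 * m - 1)
    · rw [cutoff_eq_zero_of_not_mem hm hfar.1, cutoff_eq_zero_of_not_mem hm hfar.2]
      simp only [sub_self, zero_mul, abs_zero]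
      exact div_nonneg (by positivity) (pow_nonneg (nrm_pos v).le _)
    · have hnear : (supNorm v : ℝ) ≤ 3 * m := by
        rw [not_and_or, not_not, not_not] at hfar
        rcases hfar with hin | hin
        · rw [mem_cube_iff_supNorm] at hin
          have : supNorm v ≤ 3 * m := hin.trans (Nat.sub_le _ _)
          exact_mod_cast this
        · have hin' := sub_mem_cube_succ hin (supNorm_single_one i)
          rw [add_sub_cancel_right, mem_cube_iff_supNorm] at hin'
          have : supNorm v ≤ 3 * m := hin'.trans (by omega)
          exact_mod_cast this
      have hnrm : nrm v ≤ 3 * m := by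
        unfold nrm
        refine max_le ?_ hnear
        have : (1 : ℝ) ≤ m := by exact_mod_cast hm
        linarith
      rw [abs_mul]
      have f1 : |cutoff m x' (y + e) - cutoff m x' y| ≤ 4 / m := (cutoff_diff_le hm x' y i).1
      have hnp : 0 < nrm v := nrm_pos v
      have hq : 0 ≤ U₀ / nrm v ^ p := (abs_nonneg _).trans (hu0 v)
      calc |cutoff m x' (y + e) - cutoff m x' y| * |u v| ≤ (4 / m) * (U₀ / nrm v ^ p) :=
            mul_le_mul f1 (hu0 v) (abs_nonneg _) (by positivity)
        _ = (4 * U₀ / nrm v ^ p) * (1 / m) := by ring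
        _ ≤ (4 * U₀ / nrm v ^ p) * (6 / nrm v) := by
            refine mul_le_mul_of_nonneg_left ?_
              (div_nonneg (by positivity) (pow_nonneg (nrm_pos v).le _))
            rw [div_le_div_iff₀ hmpos hnp]
            linarith
        _ = 24 * U₀ / nrm v ^ (p + 1) := by
            rw [pow_succ]; field_simp; ring
  calc |cutoff m x' (y + e) * (u (v + e) - u v) + (cutoff m x' (y + e) - cutoff m x' y) * u v|
      ≤ |cutoff m x' (y + e) * (u (v + e) - u v)| +
          |(cutoff m x' (y + e) - cutoff m x' y) * u v| := abs_add_le _ _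
    _ ≤ U₁ / nrm v ^ (p + 1) + 24 * U₀ / nrm v ^ (p + 1) := add_le_add t1 t2
    _ = (U₁ + 24 * U₀) / nrm v ^ (p + 1) := by ring

/-- **`ℓ¹` mass** `Σ_y |cpar| ≤ U₀ (1 + 2d·3^{d-1}·3^{d-p}) m^{d−p}` for `p ≤ d − 1`
(`PoissonInterior.sum_cube_inv_nrm_pow_le`). [folklore] -/
theorem sum_abs_cpar_le (hd : 0 < d) {u : (Fin d → ℤ) → ℝ} {U₀ : ℝ} {p : ℕ} (hp : p ≤ d - 1)
    (hU₀ : 0 ≤ U₀) (hu : ∀ v, |u v| ≤ U₀ / nrm v ^ p) {m : ℕ} (hm : 1 ≤ m) (x' : Fin d → ℤ) :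
    ∑ y ∈ cube x' (3 * m - 1), |cpar m x' u y| ≤
      U₀ * (1 + 2 * d * 3 ^ (d - 1) * 3 ^ (d - p)) * (m : ℝ) ^ (d - p) := by
  have hm1 : (1 : ℝ) ≤ m := by exact_mod_cast hm
  have hshift : ∑ y ∈ cube x' (3 * m - 1), |cpar m x' u y| =
      ∑ z ∈ cube (0 : Fin d → ℤ) (3 * m - 1), |cpar m x' u (z + x')| := by
    refine Finset.sum_nbij' (fun y => y - x') (fun z => z + x') ?_ ?_ ?_ ?_ ?_
    · intro y hy
      rw [mem_cube_iff_supNorm] at hy ⊢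
      simpa using hy
    · intro z hz
      rw [mem_cube_iff_supNorm] at hz ⊢
      simpa using hz
    · intro y _; simp
    · intro z _; simp
    · intro y _; simp
  rw [hshift]
  calc ∑ z ∈ cube (0 : Fin d → ℤ) (3 * m - 1), |cpar m x' u (z + x')|
      ≤ ∑ z ∈ cube (0 : Fin d → ℤ) (3 * m - 1), U₀ * (1 / nrm z ^ p) := by
        refine Finset.sum_le_sum fun z _ => ?_
        have := abs_cpar_le hm hu x' (z + x')
        rw [add_sub_cancel_right] at this
        rwa [mul_one_div]
    _ = U₀ * ∑ z ∈ cube (0 : Fin d → ℤ) (3 * m - 1), 1 / nrm z ^ p := by rw [Finset.mul_sum]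
    _ ≤ U₀ * (1 + 2 * d * 3 ^ (d - 1) * ((3 * m - 1 : ℕ) : ℝ) ^ (d - p)) :=
        mul_le_mul_of_nonneg_left (sum_cube_inv_nrm_pow_le hd _ _ hp) hU₀
    _ ≤ U₀ * ((1 + 2 * d * 3 ^ (d - 1) * 3 ^ (d - p)) * (m : ℝ) ^ (d - p)) := by
        refine mul_le_mul_of_nonneg_left ?_ hU₀
        have h3 : ((3 * m - 1 : ℕ) : ℝ) ≤ 3 * m := by
          have : (3 * m - 1 : ℕ) ≤ 3 * m := Nat.sub_le _ _
          exact_mod_cast this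
        have h4 : ((3 * m - 1 : ℕ) : ℝ) ^ (d - p) ≤ 3 ^ (d - p) * (m : ℝ) ^ (d - p) := by
          rw [← mul_pow]; exact pow_le_pow_left₀ (Nat.cast_nonneg _) h3 _
        have h5 : (1 : ℝ) ≤ (m : ℝ) ^ (d - p) := one_le_pow₀ hm1
        have h6 : (0 : ℝ) ≤ 2 * d * 3 ^ (d - 1) := by positivity
        calc 1 + 2 * d * 3 ^ (d - 1) * ((3 * m - 1 : ℕ) : ℝ) ^ (d - p)
            ≤ 1 * (m : ℝ) ^ (d - p) + 2 * d * 3 ^ (d - 1) * (3 ^ (d - p) * (m : ℝ) ^ (d - p)) :=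
              add_le_add (by linarith) (mul_le_mul_of_nonneg_left h4 h6)
          _ = _ := by ring
    _ = _ := by ring

/-- `C / b^k ≤ C 2^k / a^k` when `a/2 ≤ b`. [folklore] -/
theorem div_pow_le_of_half_le {a b C : ℝ} (ha : 0 < a) (hb : 0 < b) (h : a / 2 ≤ b) (hC : 0 ≤ C)
    (k : ℕ) : C / b ^ k ≤ C * 2 ^ k / a ^ k := by
  rw [div_le_div_iff₀ (pow_pos hb k) (pow_pos ha k)]
  calc C * a ^ k ≤ C * (2 * b) ^ k :=
        mul_le_mul_of_nonneg_left (pow_le_pow_left₀ ha.le (by linarith) k) hC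
    _ = C * 2 ^ k * b ^ k := by rw [mul_pow]; ring

/-- the DIPOLE KERNEL `u_μ(v) = G₀(v − e_μ) − G₀(v)`: `Δ u_μ = −δ_{e_μ} + δ_0`. [folklore] -/
noncomputable def dker (μ : Fin d) (v : Fin d → ℤ) : ℝ := G₀ (v - Pi.single μ 1) - G₀ v

/-- `Δ u_μ = −δ_{e_μ} + δ_0`. [folklore] -/
theorem lap_dker (hd : 3 ≤ d) (μ : Fin d) (v : Fin d → ℤ) :
    latticeLaplacianZd (dker μ) v =
      -(if v = Pi.single μ 1 then 1 else 0) + (if v = 0 then 1 else 0) := by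
  have h : dker μ = fun z => (fun w => G₀ (w - Pi.single μ 1)) z - G₀ z := rfl
  rw [h, lap_sub, lap_translate, lap_G₀ hd, lap_G₀ hd]
  by_cases hv : v = Pi.single μ 1
  · rw [if_pos hv, if_pos (sub_eq_zero.mpr hv)]; ring
  · rw [if_neg hv, if_neg (fun h' => hv (sub_eq_zero.mp h'))]; ring

/-- **envelopes of the dipole kernel**: `|u_μ| ≤ U₀/nrm^{d−1}`, `|∇^± u_μ| ≤ U₁/nrm^d`
(`PoissonInterior.G₀_diff_bound`, `G₀_diff2_bound`). [folklore] -/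
theorem dker_bounds (hd : 3 ≤ d) : ∃ U₀ U₁ : ℝ, 0 ≤ U₀ ∧ 0 ≤ U₁ ∧
    (∀ (μ : Fin d) (v : Fin d → ℤ), |dker μ v| ≤ U₀ / nrm v ^ (d - 1)) ∧
    (∀ (μ : Fin d) (v : Fin d → ℤ) (i : Fin d),
      |dker μ (v + Pi.single i 1) - dker μ v| ≤ U₁ / nrm v ^ (d - 1 + 1) ∧
      |dker μ (v - Pi.single i 1) - dker μ v| ≤ U₁ / nrm v ^ (d - 1 + 1)) := by
  obtain ⟨C₁, hC₁, h1⟩ := G₀_diff_bound hd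
  obtain ⟨C₂, hC₂, h2⟩ := G₀_diff2_bound hd
  have hdd : d - 1 + 1 = d := by omega
  have hes : ∀ i : Fin d, supNorm (-(Pi.single i (1 : ℤ) : Fin d → ℤ)) ≤ 1 := fun i => by
    rw [supNorm_neg]; exact supNorm_single_one i
  -- forward difference at `v`: a mixed second difference of `G₀` at `w = v − e_μ`
  have fwd : ∀ (μ : Fin d) (v : Fin d → ℤ) (i : Fin d),
      |dker μ (v + Pi.single i 1) - dker μ v| ≤ C₂ * 2 ^ d / nrm v ^ d := by
    intro μ v i
    have halg : dker μ (v + Pi.single i 1) - dker μ v =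
        -(G₀ (v - Pi.single μ 1 + Pi.single μ 1 + Pi.single i 1) -
          G₀ (v - Pi.single μ 1 + Pi.single μ 1) -
          G₀ (v - Pi.single μ 1 + Pi.single i 1) + G₀ (v - Pi.single μ 1)) := by
      simp only [dker, sub_add_cancel]
      rw [show v + Pi.single i 1 - Pi.single μ 1 = v - Pi.single μ 1 + Pi.single i 1 by abel]
      ring
    rw [halg, abs_neg]
    have hw : nrm v / 2 ≤ nrm (v - Pi.single μ 1) := by
      rw [sub_eq_add_neg]; exact nrm_shift_ge_half v _ (hes μ)
    exact (h2 (v - Pi.single μ 1) i μ).trans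
      (div_pow_le_of_half_le (nrm_pos v) (nrm_pos _) hw hC₂ d)
  refine ⟨C₁ * 2 ^ (d - 1), C₂ * 2 ^ d * 2 ^ d, by positivity, by positivity,
    fun μ v => ?_, fun μ v i => ⟨?_, ?_⟩⟩
  · have halg : dker μ v = -(G₀ (v - Pi.single μ 1 + Pi.single μ 1) - G₀ (v - Pi.single μ 1)) := by
      simp only [dker, sub_add_cancel]; ring
    rw [halg, abs_neg]
    have hw : nrm v / 2 ≤ nrm (v - Pi.single μ 1) := by
      rw [sub_eq_add_neg]; exact nrm_shift_ge_half v _ (hes μ)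
    exact (h1 (v - Pi.single μ 1) μ).1.trans
      (div_pow_le_of_half_le (nrm_pos v) (nrm_pos _) hw hC₁ (d - 1))
  · rw [hdd]
    refine (fwd μ v i).trans ?_
    rw [div_le_div_iff_of_pos_right (pow_pos (nrm_pos v) d)]
    have h2d : (1 : ℝ) ≤ 2 ^ d := one_le_pow₀ (by norm_num)
    have h' : 0 ≤ C₂ * 2 ^ d := by positivity
    calc C₂ * 2 ^ d = C₂ * 2 ^ d * 1 := (mul_one _).symm
      _ ≤ C₂ * 2 ^ d * 2 ^ d := mul_le_mul_of_nonneg_left h2d h'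
  · rw [hdd]
    have halg : dker μ (v - Pi.single i 1) - dker μ v =
        -(dker μ (v - Pi.single i 1 + Pi.single i 1) - dker μ (v - Pi.single i 1)) := by
      rw [sub_add_cancel]; ring
    rw [halg, abs_neg]
    have hw : nrm v / 2 ≤ nrm (v - Pi.single i 1) := by
      rw [sub_eq_add_neg]; exact nrm_shift_ge_half v _ (hes i)
    refine (fwd μ (v - Pi.single i 1) i).trans ?_
    exact div_pow_le_of_half_le (nrm_pos v) (nrm_pos _) hw (by positivity) d

/-- the DIPOLE PARAMETRIX on `ℤ^d`: `dpar m x' μ = χ_{x'} · u_μ(· − x')`. [folklore] -/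
noncomputable def dpar (m : ℕ) (x' : Fin d → ℤ) (μ : Fin d) : (Fin d → ℤ) → ℝ :=
  cpar m x' (dker μ)

/-- its residual. [folklore] -/
noncomputable def dres (m : ℕ) (x' : Fin d → ℤ) (μ : Fin d) : (Fin d → ℤ) → ℝ :=
  cres m x' (dker μ)

/-- **the dipole parametrix equation** `Δ dpar = −δ_{x'+e_μ} + δ_{x'} + dres` (`m ≥ 1`, so that
`χ = 1` at both poles). [folklore] -/
theorem lap_dpar (hd : 3 ≤ d) {m : ℕ} (hm : 1 ≤ m) (x' : Fin d → ℤ) (μ : Fin d) (y : Fin d → ℤ) :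
    latticeLaplacianZd (dpar m x' μ) y =
      -(if y = x' + Pi.single μ 1 then 1 else 0) + (if y = x' then 1 else 0) + dres m x' μ y := by
  show latticeLaplacianZd (cpar m x' (dker μ)) y = _
  rw [lap_cpar, lap_dker hd]
  have hχ1 : cutoff m x' (x' + Pi.single μ 1) = 1 := by
    refine cutoff_eq_one fun j => ?_
    rw [Pi.add_apply, add_sub_cancel_left, Pi.single_apply]
    split_ifs
    · rw [abs_one]; exact_mod_cast hm
    · simp
  by_cases h1 : y = x' + Pi.single μ 1
  · have hne : y ≠ x' := by
      rw [h1]; intro h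
      have := congrFun (add_eq_left.mp h) μ
      simp at this
    rw [if_pos (show y - x' = Pi.single μ 1 by rw [h1]; abel), if_neg (sub_ne_zero.mpr hne),
      if_pos h1, if_neg hne, h1, hχ1]
    simp [dres]
  · by_cases h0 : y = x'
    · subst h0
      rw [if_neg (fun h => h1 (by rw [sub_self] at h; rw [← h, add_zero])), sub_self, if_pos rfl,
        if_neg h1, if_pos rfl, cutoff_self]
      simp [dres]
    · rw [if_neg (fun h => h1 (by rw [← sub_add_cancel y x', h]; abel)),
        if_neg (sub_ne_zero.mpr h0), if_neg h1, if_neg h0]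
      simp [dres]

end Generic

/-! ## §2 Torus transport of the cutoff parametrix and of the dipole parametrix -/

section Torus

variable {d : ℕ} {N : Fin d → ℕ} [hN : ∀ μ, NeZero (N μ)]

/-- TORUS TRANSPORT of the cutoff parametrix, centred at `x₀`: `cpar m 0 u (liftZ (x − x₀))`.
[folklore] -/
noncomputable def cparT (m : ℕ) (u : (Fin d → ℤ) → ℝ) (x₀ x : Tor N) : ℝ :=
  cpar m 0 u (liftZ (x - x₀))

/-- TORUS TRANSPORT of its residual. [folklore] -/
noncomputable def cresT (m : ℕ) (u : (Fin d → ℤ) → ℝ) (x₀ x : Tor N) : ℝ :=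
  cres m 0 u (liftZ (x - x₀))

omit hN in
/-- support of the transported parametrix. [folklore] -/
theorem cparT_eq_zero_of_not_mem {m : ℕ} (hm : 1 ≤ m) (u : (Fin d → ℤ) → ℝ) {x₀ x : Tor N}
    (h : liftZ (x - x₀) ∉ cube (0 : Fin d → ℤ) (3 * m - 1)) : cparT m u x₀ x = 0 :=
  cpar_eq_zero_of_not_mem hm u h

omit hN in
/-- support of the transported residual. [folklore] -/
theorem cresT_eq_zero_of_not_mem {m : ℕ} (hm : 1 ≤ m) (u : (Fin d → ℤ) → ℝ) {x₀ x : Tor N}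
    (h : liftZ (x - x₀) ∉ cube (0 : Fin d → ℤ) (3 * m)) : cresT m u x₀ x = 0 :=
  cres_eq_zero_of_not_mem hm u h

/-- **the transported cutoff-parametrix equation** `Δ_𝕋 (χu)_{x₀} = χ·(Δu) ∘ lift + cresT`,
valid as soon as `6m + 6 ≤ N_μ` (the `3m`-cube and its neighbours fit inside one period; same
transport as `VectorTails.lapT_paramT`). [folklore] -/
theorem lapT_cparT {m : ℕ} (hm : 1 ≤ m) (hNm : ∀ μ, 6 * m + 6 ≤ N μ) (u : (Fin d → ℤ) → ℝ)
    (x₀ x : Tor N) :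
    lapT (cparT m u x₀) x =
      cutoff m 0 (liftZ (x - x₀)) * latticeLaplacianZd u (liftZ (x - x₀)) + cresT m u x₀ x := by
  set z := x - x₀ with hz
  have hpl : ∀ i : Fin d, x + Pi.single i 1 - x₀ = z + castT N (Pi.single i 1) := by
    intro i; rw [castT_single, hz]; abel
  have hmi : ∀ i : Fin d, x - Pi.single i 1 - x₀ = z + castT N (-Pi.single i 1) := by
    intro i; rw [castT_neg, castT_single, hz]; abel
  have hes : ∀ i : Fin d, supNorm (Pi.single i (1 : ℤ) : Fin d → ℤ) ≤ 1 := supNorm_single_one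
  have hes' : ∀ i : Fin d, supNorm (-(Pi.single i (1 : ℤ) : Fin d → ℤ)) ≤ 1 := fun i => by
    rw [supNorm_neg]; exact hes i
  by_cases hin : liftZ z ∈ cube 0 (3 * m + 1)
  · have hR : ∀ μ, (3 * m + 1 + 1) * 2 < N μ := fun μ => by have := hNm μ; omega
    have hlap : lapT (cparT m u x₀) x = latticeLaplacianZd (cpar m 0 u) (liftZ z) := by
      rw [lapT, latticeLaplacianZd_def]
      congr 1
      refine Finset.sum_congr rfl fun i _ => ?_
      simp only [cparT]
      rw [hpl i, hmi i, liftZ_add_castT hin hR (hes i), liftZ_add_castT hin hR (hes' i),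
        ← sub_eq_add_neg]
    rw [hlap, lap_cpar, sub_zero]
    rfl
  · have hR : ∀ μ, (3 * m - 1 + 2) * 2 < N μ := fun μ => by have := hNm μ; omega
    have hz' : liftZ z ∉ cube 0 (3 * m - 1 + 2) := by
      have : 3 * m - 1 + 2 = 3 * m + 1 := by omega
      rwa [this]
    have hout : liftZ z ∉ cube (0 : Fin d → ℤ) (3 * m - 1) :=
      fun h => hin (cube_mono (by omega) h)
    have h0 : cpar m 0 u (liftZ z) = 0 := cpar_eq_zero_of_not_mem hm u hout
    have hρ : cres m 0 u (liftZ z) = 0 :=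
      cres_eq_zero_of_not_mem hm u fun h => hin (cube_mono (by omega) h)
    have hnb : ∀ i : Fin d,
        cparT m u x₀ (x + Pi.single i 1) = 0 ∧ cparT m u x₀ (x - Pi.single i 1) = 0 := by
      intro i
      simp only [cparT]
      rw [hpl i, hmi i]
      exact ⟨cpar_eq_zero_of_not_mem hm u (liftZ_add_castT_not_mem hz' hR (hes i)),
        cpar_eq_zero_of_not_mem hm u (liftZ_add_castT_not_mem hz' hR (hes' i))⟩
    have hc : cparT m u x₀ x = 0 := h0
    have hr : cresT m u x₀ x = 0 := hρ
    rw [lapT, hc, hr, cutoff_eq_zero_of_not_mem hm hout]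
    simp only [mul_zero, sub_zero, add_zero, zero_mul]
    exact Finset.sum_eq_zero fun i _ => by rw [(hnb i).1, (hnb i).2, add_zero]

/-- the DIPOLE PARAMETRIX on the torus for the bond pair `x₀, x₀ + e_μ`. [folklore] -/
noncomputable def dparT (m : ℕ) (μ : Fin d) (x₀ x : Tor N) : ℝ := cparT m (dker μ) x₀ x

/-- its residual. [folklore] -/
noncomputable def dresT (m : ℕ) (μ : Fin d) (x₀ x : Tor N) : ℝ := cresT m (dker μ) x₀ x

/-- `liftZ (x − x₀) = e_μ ↔ x = x₀ + e_μ` inside one period. [folklore] -/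
theorem liftZ_sub_eq_single_iff (hN2 : ∀ μ, 2 < N μ) (x₀ x : Tor N) (μ : Fin d) :
    liftZ (x - x₀) = Pi.single μ 1 ↔ x = x₀ + unitVec N μ := by
  have hsmall : ∀ μ', ((Pi.single μ (1 : ℤ) : Fin d → ℤ) μ').natAbs * 2 < N μ' := by
    intro μ'
    have h1 : ((Pi.single μ (1 : ℤ) : Fin d → ℤ) μ').natAbs ≤ 1 := by
      rw [Pi.single_apply]; split_ifs <;> simp
    have := hN2 μ'; omega
  constructor
  · intro h
    have h2 : x - x₀ = castT N (Pi.single μ 1) := by rw [← h, castT_liftZ]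
    rw [castT_single] at h2
    rw [← sub_add_cancel x x₀, h2, add_comm]
    rfl
  · intro h
    refine liftZ_eq_of_castT_eq ?_ hsmall
    rw [castT_single, h, add_sub_cancel_left]
    rfl

/-- **the torus dipole equation** `Δ_𝕋 dparT = −δ_{x₀+e_μ} + δ_{x₀} + dresT` (`d ≥ 3`, `m ≥ 1`,
`6m + 6 ≤ N_μ`). [folklore] -/
theorem lapT_dparT (hd : 3 ≤ d) {m : ℕ} (hm : 1 ≤ m) (hNm : ∀ μ, 6 * m + 6 ≤ N μ) (μ : Fin d)
    (x₀ x : Tor N) :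
    lapT (dparT m μ x₀) x =
      -(if x = x₀ + unitVec N μ then 1 else 0) + (if x = x₀ then 1 else 0) + dresT m μ x₀ x := by
  have hl1 := liftZ_sub_eq_single_iff (fun μ' => by have := hNm μ'; omega) x₀ x μ
  have hl0 : liftZ (x - x₀) = 0 ↔ x = x₀ := by rw [liftZ_eq_zero_iff, sub_eq_zero]
  show lapT (cparT m (dker μ) x₀) x = _
  rw [lapT_cparT hm hNm, lap_dker hd]
  change _ = _ + cresT m (dker μ) x₀ x
  by_cases hx1 : x = x₀ + unitVec N μ
  · have hA : liftZ (x - x₀) = Pi.single μ 1 := hl1.mpr hx1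
    have hx0 : x ≠ x₀ := by
      intro h
      rw [h, sub_self, liftZ_zero] at hA
      have := congrFun hA μ
      simp at this
    rw [if_pos hA, if_neg (mt hl0.mp hx0), if_pos hx1, if_neg hx0, hA, cutoff_eq_one]
    · ring
    · intro j
      rw [Pi.zero_apply, sub_zero, Pi.single_apply]
      split_ifs
      · rw [abs_one]; exact_mod_cast hm
      · simp
  · by_cases hx0 : x = x₀
    · have hA : liftZ (x - x₀) = 0 := hl0.mpr hx0
      rw [if_neg (mt hl1.mp hx1), if_pos hA, if_neg hx1, if_pos hx0, hA, cutoff_self]; ring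
    · rw [if_neg (mt hl1.mp hx1), if_neg (mt hl0.mp hx0), if_neg hx1, if_neg hx0]; ring

omit hN in
/-- support of the torus dipole parametrix. [folklore] -/
theorem dparT_eq_zero_of_not_mem {m : ℕ} (hm : 1 ≤ m) (μ : Fin d) {x₀ x : Tor N}
    (h : liftZ (x - x₀) ∉ cube (0 : Fin d → ℤ) (3 * m - 1)) : dparT m μ x₀ x = 0 :=
  cpar_eq_zero_of_not_mem hm _ h

omit hN in
/-- support of the torus dipole residual. [folklore] -/
theorem dresT_eq_zero_of_not_mem {m : ℕ} (hm : 1 ≤ m) (μ : Fin d) {x₀ x : Tor N}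
    (h : liftZ (x - x₀) ∉ cube (0 : Fin d → ℤ) (3 * m)) : dresT m μ x₀ x = 0 :=
  cres_eq_zero_of_not_mem hm _ h

end Torus

/-! ### §2b Envelopes of the torus dipole parametrix, constants BEFORE the volume and the centre -/

section TorusEnvelopes

variable {d : ℕ}

/-- `|dparT| ≤ D₀ / nrm(liftZ (x − x₀))^{d−1}`. [folklore] -/
theorem abs_dparT_le (hd : 3 ≤ d) : ∃ D₀ : ℝ, 0 ≤ D₀ ∧
    ∀ (N : Fin d → ℕ) [∀ μ, NeZero (N μ)] (m : ℕ), 1 ≤ m → ∀ (μ : Fin d) (x₀ x : Tor N),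
      |dparT m μ x₀ x| ≤ D₀ / nrm (liftZ (x - x₀)) ^ (d - 1) := by
  obtain ⟨U₀, U₁, hU₀, hU₁, h0, h1⟩ := dker_bounds hd
  refine ⟨U₀, hU₀, fun N _ m hm μ x₀ x => ?_⟩
  have := abs_cpar_le hm (h0 μ) 0 (liftZ (x - x₀))
  rwa [sub_zero] at this

/-- `|dparT(x + e_i) − dparT(x)| ≤ D₁ / nrm^d` in the interior (`liftZ (x − x₀)` in the
`3m+1`-cube). [folklore] -/
theorem abs_dparT_diff_le (hd : 3 ≤ d) : ∃ D₁ : ℝ, 0 ≤ D₁ ∧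
    ∀ (N : Fin d → ℕ) [∀ μ, NeZero (N μ)] (m : ℕ), 1 ≤ m → (∀ μ, 6 * m + 6 ≤ N μ) →
      ∀ (μ : Fin d) (x₀ x : Tor N) (i : Fin d),
        liftZ (x - x₀) ∈ cube (0 : Fin d → ℤ) (3 * m + 1) →
        |dparT m μ x₀ (x + Pi.single i 1) - dparT m μ x₀ x| ≤ D₁ / nrm (liftZ (x - x₀)) ^ d := by
  obtain ⟨U₀, U₁, hU₀, hU₁, h0, h1⟩ := dker_bounds hd
  have hdd : d - 1 + 1 = d := by omega
  refine ⟨U₁ + 24 * U₀, by positivity, fun N _ m hm hNm μ x₀ x i hin => ?_⟩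
  have hR : ∀ μ, (3 * m + 1 + 1) * 2 < N μ := fun μ => by have := hNm μ; omega
  have e1 : x + Pi.single i 1 - x₀ = (x - x₀) + castT N (Pi.single i 1) := by
    rw [castT_single]; abel
  simp only [dparT, cparT]
  rw [e1, liftZ_add_castT hin hR (supNorm_single_one i)]
  have := abs_cpar_diff_le hU₀ (h0 μ) (fun v j => (h1 μ v j).1) hm 0 (liftZ (x - x₀)) i
  rwa [sub_zero, hdd] at this

/-- `|dresT| ≤ Dρ / m^{d+1}` everywhere. [folklore] -/
theorem abs_dresT_le (hd : 3 ≤ d) : ∃ Dρ : ℝ, 0 ≤ Dρ ∧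
    ∀ (N : Fin d → ℕ) [∀ μ, NeZero (N μ)] (m : ℕ), 1 ≤ m → ∀ (μ : Fin d) (x₀ x : Tor N),
      |dresT m μ x₀ x| ≤ Dρ / (m : ℝ) ^ (d + 1) := by
  obtain ⟨U₀, U₁, hU₀, hU₁, h0, h1⟩ := dker_bounds hd
  have hdd : d - 1 + 2 = d + 1 := by omega
  refine ⟨d * (4 * (2 * U₁) * 2 ^ (d - 1 + 1) + 4 * U₀ * 2 ^ (d - 1)), by positivity,
    fun N _ m hm μ x₀ x => ?_⟩
  have := abs_cres_le hU₀ hU₁ (h0 μ) (h1 μ) hm 0 (liftZ (x - x₀))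
  rwa [hdd] at this

/-- `Σ_x |dparT m μ x₀ x| ≤ D m` on the torus (the lift is injective; `p = d − 1`). [folklore] -/
theorem sum_abs_dparT_le (hd : 3 ≤ d) : ∃ D : ℝ, 0 ≤ D ∧
    ∀ (N : Fin d → ℕ) [∀ μ, NeZero (N μ)] (m : ℕ), 1 ≤ m → ∀ (μ : Fin d) (x₀ : Tor N),
      ∑ x, |dparT m μ x₀ x| ≤ D * (m : ℝ) := by
  have hd0 : 0 < d := by omega
  obtain ⟨U₀, U₁, hU₀, hU₁, h0, h1⟩ := dker_bounds hd
  refine ⟨U₀ * (1 + 2 * d * 3 ^ (d - 1) * 3 ^ (d - (d - 1))), by positivity,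
    fun N _ m hm μ x₀ => ?_⟩
  classical
  set g : Tor N → (Fin d → ℤ) := fun x => liftZ (x - x₀) with hg
  have hinj : ∀ a ∈ (Finset.univ : Finset (Tor N)), ∀ b ∈ Finset.univ, g a = g b → a = b := by
    intro a _ b _ hab
    have := liftZ_injective hab
    simpa using this
  have step1 : ∑ x, |dparT m μ x₀ x| = ∑ w ∈ Finset.univ.image g, |dpar m 0 μ w| := by
    rw [Finset.sum_image hinj]
    simp only [hg, dparT, cparT, dpar]
  rw [step1]
  have step2 : ∑ w ∈ Finset.univ.image g, |dpar m 0 μ w| =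
      ∑ w ∈ (Finset.univ.image g).filter (fun w => w ∈ cube (0 : Fin d → ℤ) (3 * m - 1)),
        |dpar m 0 μ w| := by
    rw [Finset.sum_filter_of_ne]
    intro w _ hw
    by_contra hmem
    exact hw (by rw [dpar, cpar_eq_zero_of_not_mem hm _ hmem, abs_zero])
  rw [step2]
  have hmain := sum_abs_cpar_le hd0 (p := d - 1) le_rfl hU₀ (h0 μ) hm 0
  have hpow : (m : ℝ) ^ (d - (d - 1)) = m := by rw [show d - (d - 1) = 1 by omega, pow_one]
  rw [hpow] at hmain
  calc ∑ w ∈ (Finset.univ.image g).filter (fun w => w ∈ cube (0 : Fin d → ℤ) (3 * m - 1)),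
        |dpar m 0 μ w|
      ≤ ∑ w ∈ cube (0 : Fin d → ℤ) (3 * m - 1), |dpar m 0 μ w| := by
        refine Finset.sum_le_sum_of_subset_of_nonneg ?_ fun _ _ _ => abs_nonneg _
        intro w hw
        exact (Finset.mem_filter.mp hw).2
    _ ≤ _ := hmain

end TorusEnvelopes

/-! ## §3 The dipole entry identity: differences of `𝒢 = Δ_a⁻¹` in the SOURCE bond -/

section DipoleDictionary

variable {𝕜 : Type*} [RCLike 𝕜] {X : Type*} [Fintype X]

/-- **Entry-difference identity of the dipole parametrix.** If `G` is a left inverse of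
`Δ = Lc + V` and `h` is a parametrix for the DIFFERENCE of the columns `x₁`, `x₀` of `Lc⁻¹` with
residual `ρ`, `Lc h = c (δ_{x₁} − δ_{x₀} − ρ)`, `c ≠ 0`, then
`G x x₁ − G x x₀ = (G ρ) x + c⁻¹ (h x − (G (V h)) x)` (`VectorTails.entry_eq_of_parametrix` for a
dipole source). [folklore] -/
theorem entry_diff_eq_of_parametrix [DecidableEq X] {G Δ Lc V : Matrix X X 𝕜} {c : 𝕜}
    (hG : G * Δ = 1) (hΔ : Δ = Lc + V) {x₁ x₀ : X} {h ρ : X → 𝕜}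
    (hpar : Lc *ᵥ h = c • (Pi.single x₁ 1 - Pi.single x₀ 1 - ρ)) (hc : c ≠ 0) (x : X) :
    G x x₁ - G x x₀ = (G *ᵥ ρ) x + c⁻¹ * (h x - (G *ᵥ (V *ᵥ h)) x) := by
  have key : G *ᵥ (Δ *ᵥ h) = h := by rw [Matrix.mulVec_mulVec, hG, Matrix.one_mulVec]
  rw [hΔ, Matrix.add_mulVec, hpar, Matrix.mulVec_add, Matrix.mulVec_smul, Matrix.mulVec_sub,
    Matrix.mulVec_sub] at key
  have hs1 : (G *ᵥ (Pi.single x₁ (1 : 𝕜))) x = G x x₁ := by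
    simp [Matrix.mulVec, dotProduct_single]
  have hs0 : (G *ᵥ (Pi.single x₀ (1 : 𝕜))) x = G x x₀ := by
    simp [Matrix.mulVec, dotProduct_single]
  have hx := congrFun key x
  simp only [Pi.add_apply, Pi.smul_apply, Pi.sub_apply, smul_eq_mul, hs1, hs0] at hx
  have h2 : c⁻¹ * (h x - (G *ᵥ (V *ᵥ h)) x) = G x x₁ - G x x₀ - (G *ᵥ ρ) x := by
    rw [← hx]; field_simp; ring
  rw [h2]; ring

end DipoleDictionary

section DipoleShift

variable {d : ℕ} {N : Fin d → ℕ} [hN : ∀ μ, NeZero (N μ)]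

/-- **Mixed identity**: subtracting the dipole entry identities at `(x + e_μ, κ)` and `(x, κ)`,
`∂_μ G(p, x₁) − ∂_μ G(p, x₀) = (∂_μG ρ)(p) + c⁻¹ ((h(p+e_μ) − h(p)) − (∂_μG (V h))(p))`
(`VectorTailsLoc.shiftDiff`). [folklore] -/
theorem shiftDiff_entry_diff_eq {G Δ Lc V : Matrix (Tor N × Fin d) (Tor N × Fin d) ℂ} {c : ℂ}
    (hG : G * Δ = 1) (hΔ : Δ = Lc + V) {x₁ x₀ : Tor N × Fin d} {h ρ : Tor N × Fin d → ℂ}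
    (hpar : Lc *ᵥ h = c • (Pi.single x₁ 1 - Pi.single x₀ 1 - ρ)) (hc : c ≠ 0) (μ : Fin d)
    (p : Tor N × Fin d) :
    shiftDiff G μ p x₁ - shiftDiff G μ p x₀ = (shiftDiff G μ *ᵥ ρ) p +
      c⁻¹ * ((h (p.1 + unitVec N μ, p.2) - h p) - (shiftDiff G μ *ᵥ (V *ᵥ h)) p) := by
  rw [shiftDiff_mulVec, shiftDiff_mulVec]
  simp only [shiftDiff]
  have e1 := entry_diff_eq_of_parametrix hG hΔ hpar hc (p.1 + unitVec N μ, p.2)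
  have e0 := entry_diff_eq_of_parametrix hG hΔ hpar hc p
  linear_combination e1 - e0

end DipoleShift

section DipoleColumn

variable {d : ℕ} (n : ℕ) [NeZero n] (M : Fin d → ℕ) [hM : ∀ μ, NeZero (M μ)]

/-- **The dipole-column equation**: if `f` solves `Δ₁ f = −δ_{x₁} + δ_{x₀} + ρ` pointwise on the
fine torus (as `lapT_dparT` provides), then
`Lap (colOf f ν₀) = n² • (δ_{(x₁,ν₀)} − δ_{(x₀,ν₀)} − colOf ρ ν₀)`. [folklore] -/
theorem Lap_colOf_of_pointwise₂ {f ρ : Tor (fine n M) → ℝ} {x₀ x₁ : Tor (fine n M)}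
    (hf : ∀ x, lapTor n M f x =
      -(if x = x₁ then 1 else 0) + (if x = x₀ then 1 else 0) + ρ x) (ν₀ : Fin d) :
    Lap n M *ᵥ colOf n M f ν₀ =
      ((n : ℂ) ^ 2) • (Pi.single (x₁, ν₀) 1 - Pi.single (x₀, ν₀) 1 - colOf n M ρ ν₀) := by
  rw [Lap_colOf]
  funext ⟨x, κ⟩
  simp only [colOf, Pi.smul_apply, Pi.sub_apply, smul_eq_mul]
  have hδ : ∀ x' : Tor (fine n M),
      (Pi.single (x', ν₀) (1 : ℂ) : Tor (fine n M) × Fin d → ℂ) (x, κ) =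
        if κ = ν₀ then (if x = x' then 1 else 0) else 0 := by
    intro x'
    by_cases hκ : κ = ν₀
    · rw [if_pos hκ, hκ]
      by_cases hx : x = x'
      · rw [if_pos hx, hx]; exact Pi.single_eq_same _ _
      · rw [if_neg hx, Pi.single_eq_of_ne (fun h => hx (congrArg Prod.fst h))]
    · rw [if_neg hκ, Pi.single_eq_of_ne (fun h => hκ (congrArg Prod.snd h))]
  rw [hδ x₁, hδ x₀]
  by_cases hκ : κ = ν₀
  · simp only [hκ, if_true]
    rw [hf x]
    push_cast
    split_ifs <;> push_cast <;> ring
  · simp only [hκ, if_false]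
    simp

variable (a : ℝ) (hn : 1 ≤ n) (ha : 0 < a)

/-- **THE DIPOLE IDENTITY FOR THE ENTRIES OF `𝒢 = Δ_a⁻¹`** (generic scalar dipole parametrix):
if `Δ₁ f = −δ_{x₁} + δ_{x₀} + ρ` pointwise, then for every `i`
`𝒢(i,(x₁,ν₀)) − 𝒢(i,(x₀,ν₀)) = (𝒢 colOf ρ)(i) + n⁻² (colOf f (i) − (𝒢 (V colOf f))(i))`.
[folklore] -/
theorem calG_entry_diff_eq_of_pointwise {f ρ : Tor (fine n M) → ℝ} {x₀ x₁ : Tor (fine n M)}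
    (hf : ∀ x, lapTor n M f x =
      -(if x = x₁ then 1 else 0) + (if x = x₀ then 1 else 0) + ρ x) (ν₀ : Fin d)
    (i : Tor (fine n M) × Fin d) :
    calG n hn M a ha i (x₁, ν₀) - calG n hn M a ha i (x₀, ν₀)
      = (calG n hn M a ha *ᵥ colOf n M ρ ν₀) i
        + ((n : ℂ) ^ 2)⁻¹ * (colOf n M f ν₀ i
            - (calG n hn M a ha *ᵥ (Vop n M a *ᵥ colOf n M f ν₀)) i) :=
  entry_diff_eq_of_parametrix (calG_mul_DeltaA n hn M a ha) (DeltaA_eq_Lap_add_Vop n M a)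
    (Lap_colOf_of_pointwise₂ n M hf ν₀) (pow_ne_zero 2 (Nat.cast_ne_zero.mpr (NeZero.ne n))) i

/-- the mixed (shifted) version: `∂_μ` in the observation variable of the source-bond
difference. [folklore] -/
theorem shiftDiff_calG_entry_diff_eq_of_pointwise {f ρ : Tor (fine n M) → ℝ}
    {x₀ x₁ : Tor (fine n M)}
    (hf : ∀ x, lapTor n M f x =
      -(if x = x₁ then 1 else 0) + (if x = x₀ then 1 else 0) + ρ x) (ν₀ : Fin d)
    (μ : Fin d) (p : Tor (fine n M) × Fin d) :
    shiftDiff (calG n hn M a ha) μ p (x₁, ν₀) - shiftDiff (calG n hn M a ha) μ p (x₀, ν₀)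
      = (shiftDiff (calG n hn M a ha) μ *ᵥ colOf n M ρ ν₀) p
        + ((n : ℂ) ^ 2)⁻¹ * ((colOf n M f ν₀ (p.1 + unitVec (fine n M) μ, p.2) - colOf n M f ν₀ p)
            - (shiftDiff (calG n hn M a ha) μ *ᵥ (Vop n M a *ᵥ colOf n M f ν₀)) p) :=
  shiftDiff_entry_diff_eq (calG_mul_DeltaA n hn M a ha) (DeltaA_eq_Lap_add_Vop n M a)
    (Lap_colOf_of_pointwise₂ n M hf ν₀) (pow_ne_zero 2 (Nat.cast_ne_zero.mpr (NeZero.ne n))) μ p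

/-- the dipole-parametrix column for the bond pair `(x₀,ν₀)`, `(x₀+e_μ,ν₀)`. [folklore] -/
noncomputable def colDpar (m : ℕ) (μ : Fin d) (x₀ : Tor (fine n M)) (ν₀ : Fin d) :
    Tor (fine n M) × Fin d → ℂ :=
  colOf n M (dparT m μ x₀) ν₀

/-- its residual column. [folklore] -/
noncomputable def colDres (m : ℕ) (μ : Fin d) (x₀ : Tor (fine n M)) (ν₀ : Fin d) :
    Tor (fine n M) × Fin d → ℂ :=
  colOf n M (dresT m μ x₀) ν₀

/-- **THE DIPOLE IDENTITY FOR BAŁABAN'S `𝒢 = Δ_a⁻¹` AT `U = 1`**, realised by the cutoff dipole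
parametrix of §2: for `d ≥ 3`, `m ≥ 1`, `6m + 6 ≤ nM_μ`,
`𝒢(i,(x₀+e_μ,ν₀)) − 𝒢(i,(x₀,ν₀)) = (𝒢 colDres)(i) + n⁻² (colDpar(i) − (𝒢 (V colDpar))(i))`.
[folklore] -/
theorem calG_entry_diff_eq (hd : 3 ≤ d) {m : ℕ} (hm : 1 ≤ m)
    (hNm : ∀ μ, 6 * m + 6 ≤ fine n M μ) (μ : Fin d) (x₀ : Tor (fine n M)) (ν₀ : Fin d)
    (i : Tor (fine n M) × Fin d) :
    calG n hn M a ha i (x₀ + unitVec (fine n M) μ, ν₀) - calG n hn M a ha i (x₀, ν₀)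
      = (calG n hn M a ha *ᵥ colDres n M m μ x₀ ν₀) i
        + ((n : ℂ) ^ 2)⁻¹ * (colDpar n M m μ x₀ ν₀ i
            - (calG n hn M a ha *ᵥ (Vop n M a *ᵥ colDpar n M m μ x₀ ν₀)) i) :=
  calG_entry_diff_eq_of_pointwise n M a hn ha (fun x => lapT_dparT hd hm hNm μ x₀ x) ν₀ i

/-- the mixed version `∂_{x,μ'} [𝒢(·,(x₀+e_μ,ν₀)) − 𝒢(·,(x₀,ν₀))]`. [folklore] -/
theorem shiftDiff_calG_entry_diff_eq (hd : 3 ≤ d) {m : ℕ} (hm : 1 ≤ m)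
    (hNm : ∀ μ, 6 * m + 6 ≤ fine n M μ) (μ : Fin d) (x₀ : Tor (fine n M)) (ν₀ : Fin d)
    (μ' : Fin d) (p : Tor (fine n M) × Fin d) :
    shiftDiff (calG n hn M a ha) μ' p (x₀ + unitVec (fine n M) μ, ν₀)
        - shiftDiff (calG n hn M a ha) μ' p (x₀, ν₀)
      = (shiftDiff (calG n hn M a ha) μ' *ᵥ colDres n M m μ x₀ ν₀) p
        + ((n : ℂ) ^ 2)⁻¹ * ((colDpar n M m μ x₀ ν₀ (p.1 + unitVec (fine n M) μ', p.2)
              - colDpar n M m μ x₀ ν₀ p)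
            - (shiftDiff (calG n hn M a ha) μ' *ᵥ (Vop n M a *ᵥ colDpar n M m μ x₀ ν₀)) p) :=
  shiftDiff_calG_entry_diff_eq_of_pointwise n M a hn ha (fun x => lapT_dparT hd hm hNm μ x₀ x)
    ν₀ μ' p

end DipoleColumn

/-! ## §4 Envelopes of a general column and the remainder constants of the dipole -/

section ColumnEnvelopes

open Literature.MathematicalPhysics.QuantumFieldTheory.Balaban1983to89.Beta.PoissonInterior

variable {d : ℕ} (n : ℕ) [NeZero n] (M : Fin d → ℕ) [hM : ∀ μ, NeZero (M μ)]

/-- **Envelope of a bounded column of fine support radius `3m`** (`m ≤ n`): zero beyond block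
distance `3`, so `‖colOf g|_{y'}‖ ≤ K e^{3δ'} e^{-δ' tdist(y', blk x₀)}`
(generalises `VectorTailsLoc.resid_envelope`). [folklore] -/
theorem col_envelope {g : Tor (fine n M) → ℝ} {x₀ : Tor (fine n M)} {m : ℕ} (hmn : m ≤ n)
    {K : ℝ} (hK : 0 ≤ K) (hg : ∀ x, |g x| ≤ K)
    (hsupp : ∀ x, g x ≠ 0 → liftZ (x - x₀) ∈ cube (0 : Fin d → ℤ) (3 * m))
    (ν₀ : Fin d) {δ' : ℝ} (hδ' : 0 ≤ δ') (y' : Tor M) :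
    ‖restrictBlk (fun p : Tor (fine n M) × Fin d => B5Blocks16.blockOf n M p.1)
        (colOf n M g ν₀) y'‖ ≤
      K * Real.exp (δ' * 3) * Real.exp (-(δ' * (tdist y' (B5Blocks16.blockOf n M x₀) : ℝ))) := by
  refine norm_restrictBlk_le_envelope (dist := fun y y' : Tor M => (tdist y y' : ℝ))
    (y₀ := B5Blocks16.blockOf n M x₀) (ℓ := 3) hK hδ' (fun z => ?_) (fun z hz => ?_) y'
  · exact (norm_colOf_le n M _ ν₀ z).trans (hg z.1)
  · have h1 : g z.1 ≠ 0 := colOf_ne_zero n M hz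
    have h2 := hsupp z.1 h1
    have h3 : supNorm (liftZ (z.1 - x₀)) ≤ 3 * n :=
      (mem_cube_zero_iff.mp h2).trans (Nat.mul_le_mul_left 3 hmn)
    have h4 := tdist_blockOf_le_of_supNorm_le n M h3
    rw [tdist_comm] at h4
    exact_mod_cast h4

/-- **Envelope of `aQ*Q` of an `ℓ¹`-bounded column of fine support radius `3m − 1`** (`m ≤ n`):
`≤ a B η^d e^{5δ'} e^{-δ' tdist(y', blk x₀)}` (generalises `VectorTailsLoc.aQQ_envelope`).
[folklore] -/
theorem aQQ_col_envelope {a : ℝ} (ha : 0 ≤ a) {g : Tor (fine n M) → ℝ} {x₀ : Tor (fine n M)}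
    {m : ℕ} (hmn : m ≤ n) {B : ℝ} (hB : 0 ≤ B) (hsum : ∑ x, |g x| ≤ B)
    (hsupp : ∀ x, g x ≠ 0 → liftZ (x - x₀) ∈ cube (0 : Fin d → ℤ) (3 * m - 1))
    (ν₀ : Fin d) {δ' : ℝ} (hδ' : 0 ≤ δ') (y' : Tor M) :
    ‖restrictBlk (fun p : Tor (fine n M) × Fin d => B5Blocks16.blockOf n M p.1)
        ((((a : ℂ) • (QvAdj n M * QvOp n M)) *ᵥ colOf n M g ν₀)) y'‖ ≤
      a * B / (n : ℝ) ^ d * Real.exp (δ' * 5) *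
        Real.exp (-(δ' * (tdist y' (B5Blocks16.blockOf n M x₀) : ℝ))) := by
  refine norm_restrictBlk_le_envelope (dist := fun y y' : Tor M => (tdist y y' : ℝ))
    (y₀ := B5Blocks16.blockOf n M x₀) (ℓ := 5) (by positivity) hδ' (fun z => ?_)
    (fun z hz => ?_) y'
  · refine (norm_aQQ_colOf_le n M ha g ν₀ z).trans ?_
    rw [mul_assoc, mul_div_assoc]
    refine mul_le_mul_of_nonneg_left ?_ ha
    rw [div_eq_mul_one_div B, mul_comm B]
    exact mul_le_mul_of_nonneg_left hsum (by positivity)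
  · rw [Matrix.smul_mulVec, Pi.smul_apply, smul_ne_zero_iff] at hz
    obtain ⟨i', hQQ, hH⟩ := exists_of_mulVec_ne_zero _ _ z hz.2
    obtain ⟨b, hbz, hbi⟩ := exists_of_QQ_ne_zero n M z i' hQQ
    have t1 : tdist b.1 (B5Blocks16.blockOf n M z.1) ≤ 1 :=
      tdist_blockOf_le_one_of_QvOp_ne_zero n M b.1 b.2 z.1 z.2 hbz
    have t2 : tdist b.1 (B5Blocks16.blockOf n M i'.1) ≤ 1 :=
      tdist_blockOf_le_one_of_QvOp_ne_zero n M b.1 b.2 i'.1 i'.2 hbi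
    have h1 : g i'.1 ≠ 0 := colOf_ne_zero n M hH
    have h2 := hsupp i'.1 h1
    have h3 : supNorm (liftZ (i'.1 - x₀)) ≤ 3 * n :=
      (mem_cube_zero_iff.mp h2).trans ((Nat.sub_le _ _).trans (Nat.mul_le_mul_left 3 hmn))
    have t3 := tdist_blockOf_le_of_supNorm_le n M h3
    have tri1 := tdist_triangle (B5Blocks16.blockOf n M z.1) b.1 (B5Blocks16.blockOf n M x₀)
    have tri2 := tdist_triangle b.1 (B5Blocks16.blockOf n M i'.1) (B5Blocks16.blockOf n M x₀)
    rw [tdist_comm] at t1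
    rw [tdist_comm] at t3
    have : tdist (B5Blocks16.blockOf n M z.1) (B5Blocks16.blockOf n M x₀) ≤ 5 := by omega
    exact_mod_cast this

/-- **Envelope of `∂P∂* H` for an `ℓ¹`-bounded column of fine support radius `3m − 1`** from an
entry bound of (1.126) shape: `≤ C_K B η^d e^{4δ₀'} e^{-δ₀' tdist(y', blk x₀)}` (`m ≤ n`;
generalises `VectorTailsLoc.dPd_envelope`). [folklore] -/
theorem dPd_col_envelope {CK δ₀' : ℝ} (hCK : 0 ≤ CK) (hδ : 0 ≤ δ₀')
    (hK : ∀ (x : Tor (fine n M)) (κ : Fin d) (x' : Tor (fine n M)) (ν : Fin d),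
      ‖dPd n M (x, κ) (x', ν)‖ ≤ CK / (n : ℝ) ^ d * Real.exp (-(δ₀' * (tdist x x' : ℝ) / n)))
    {g : Tor (fine n M) → ℝ} {x₀ : Tor (fine n M)} {m : ℕ} (hmn : m ≤ n) {B : ℝ} (hB : 0 ≤ B)
    (hsum : ∑ x, |g x| ≤ B)
    (hsupp : ∀ x, g x ≠ 0 → liftZ (x - x₀) ∈ cube (0 : Fin d → ℤ) (3 * m - 1))
    (ν₀ : Fin d) (y' : Tor M) :
    ‖restrictBlk (fun p : Tor (fine n M) × Fin d => B5Blocks16.blockOf n M p.1)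
        (dPd n M *ᵥ colOf n M g ν₀) y'‖ ≤
      CK * B / (n : ℝ) ^ d * Real.exp (δ₀' * 4) *
        Real.exp (-(δ₀' * (tdist y' (B5Blocks16.blockOf n M x₀) : ℝ))) := by
  have hn : (0 : ℝ) < n := Nat.cast_pos.mpr (NeZero.pos n)
  set E := Real.exp (-(δ₀' * (tdist y' (B5Blocks16.blockOf n M x₀) : ℝ))) with hE
  have hRHS : 0 ≤ CK * B / (n : ℝ) ^ d * Real.exp (δ₀' * 4) * E := by positivity
  refine (pi_norm_le_iff_of_nonneg hRHS).mpr fun z => ?_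
  by_cases hz : B5Blocks16.blockOf n M z.1 = y'
  swap
  · rw [show restrictBlk (fun p : Tor (fine n M) × Fin d => B5Blocks16.blockOf n M p.1)
        (dPd n M *ᵥ colOf n M g ν₀) y' z = 0 from if_neg hz, norm_zero]
    exact hRHS
  simp only [restrictBlk, hz, if_true]
  have step1 : ‖(dPd n M *ᵥ colOf n M g ν₀) z‖ ≤
      ∑ p, CK / (n : ℝ) ^ d * Real.exp (δ₀' * 3) *
        Real.exp (-(δ₀' * (tdist x₀ z.1 : ℝ) / n)) * ‖colOf n M g ν₀ p‖ := by
    simp only [Matrix.mulVec, dotProduct]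
    refine (norm_sum_le _ _).trans (Finset.sum_le_sum fun p _ => ?_)
    rw [norm_mul]
    by_cases hp : colOf n M g ν₀ p = 0
    · rw [hp, norm_zero, mul_zero, mul_zero]
    refine mul_le_mul_of_nonneg_right ?_ (norm_nonneg _)
    have h1 : g p.1 ≠ 0 := colOf_ne_zero n M hp
    have h2 := hsupp p.1 h1
    have h3 : supNorm (liftZ (p.1 - x₀)) ≤ 3 * n :=
      (mem_cube_zero_iff.mp h2).trans ((Nat.sub_le _ _).trans (Nat.mul_le_mul_left 3 hmn))
    have h4 : (tdist x₀ p.1 : ℝ) ≤ 3 * n := by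
      have : tdist x₀ p.1 = supNorm (liftZ (p.1 - x₀)) := rfl
      rw [this]; exact_mod_cast h3
    have tri : (tdist z.1 x₀ : ℝ) ≤ tdist z.1 p.1 + tdist p.1 x₀ := by
      exact_mod_cast tdist_triangle z.1 p.1 x₀
    rw [tdist_comm p.1 x₀] at tri
    have hKz := hK z.1 z.2 p.1 p.2
    simp only [Prod.mk.eta] at hKz
    refine hKz.trans ?_
    rw [mul_assoc]
    refine mul_le_mul_of_nonneg_left ?_ (by positivity)
    rw [← Real.exp_add]
    refine Real.exp_le_exp.mpr ?_
    rw [tdist_comm x₀ z.1]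
    have e1 : δ₀' * (tdist z.1 x₀ : ℝ) / n ≤ δ₀' * (tdist z.1 p.1 : ℝ) / n + δ₀' * 3 := by
      have : δ₀' * (tdist z.1 x₀ : ℝ) / n ≤ δ₀' * ((tdist z.1 p.1 : ℝ) + 3 * n) / n := by
        refine div_le_div_of_nonneg_right (mul_le_mul_of_nonneg_left (by linarith) hδ) hn.le
      refine this.trans (le_of_eq ?_)
      field_simp
    linarith
  have step2 : ∑ p, CK / (n : ℝ) ^ d * Real.exp (δ₀' * 3) *
        Real.exp (-(δ₀' * (tdist x₀ z.1 : ℝ) / n)) * ‖colOf n M g ν₀ p‖ ≤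
      CK / (n : ℝ) ^ d * Real.exp (δ₀' * 3) *
        Real.exp (-(δ₀' * (tdist x₀ z.1 : ℝ) / n)) * B := by
    rw [← Finset.mul_sum]
    refine mul_le_mul_of_nonneg_left ?_ (by positivity)
    rw [sum_norm_colOf]
    exact hsum
  have step3 := exp_fine_le_exp_block n M hδ x₀ z.1
  rw [hz] at step3
  refine step1.trans (step2.trans ?_)
  have e4 : Real.exp (δ₀' * 4) = Real.exp (δ₀' * 3) * Real.exp δ₀' := by
    rw [← Real.exp_add]; ring_nf
  rw [e4]
  have hA : 0 ≤ CK / (n : ℝ) ^ d * Real.exp (δ₀' * 3) * B := by positivity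
  calc CK / (n : ℝ) ^ d * Real.exp (δ₀' * 3) * Real.exp (-(δ₀' * (tdist x₀ z.1 : ℝ) / n)) * B
      = CK / (n : ℝ) ^ d * Real.exp (δ₀' * 3) * B
        * Real.exp (-(δ₀' * (tdist x₀ z.1 : ℝ) / n)) := by ring
    _ ≤ CK / (n : ℝ) ^ d * Real.exp (δ₀' * 3) * B * (Real.exp δ₀' * E) :=
        mul_le_mul_of_nonneg_left step3 hA
    _ = CK * B / (n : ℝ) ^ d * (Real.exp (δ₀' * 3) * Real.exp δ₀') * E := by ring

end ColumnEnvelopes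

section DipoleProfile

/-- **The dipole remainder constants are `≤ B η^{d+1}`** once `1 ≤ m ≤ n ≤ R m`:
`Dρ/m^{d+1} ≤ Dρ R^{d+1} η^{d+1}` and `η² m η^d ≤ η^{d+1}`. [folklore] -/
theorem dipole_consts_le (d : ℕ) {N mR R Cρ CK CQ a δ₀' : ℝ} (hN : 0 < N) (hm : 0 < mR)
    (hmN : mR ≤ N) (hRm : N ≤ R * mR) (hCρ : 0 ≤ Cρ) (hCK : 0 ≤ CK) (hCQ : 0 ≤ CQ)
    (ha : 0 ≤ a) :
    Cρ / mR ^ (d + 1) * Real.exp (δ₀' * 3) + (1 / N) ^ 2 *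
      (CK * (CQ * mR) / N ^ d * Real.exp (δ₀' * 4)
        + a * (CQ * mR) / N ^ d * Real.exp (δ₀' * 5)) ≤
      (Cρ * Real.exp (δ₀' * 3) * R ^ (d + 1) + (CK * CQ * Real.exp (δ₀' * 4)
          + a * CQ * Real.exp (δ₀' * 5))) * (1 / N) ^ (d + 1) := by
  rw [add_mul]
  refine add_le_add ?_ ?_
  · have h1 : 1 / mR ^ (d + 1) ≤ R ^ (d + 1) * (1 / N) ^ (d + 1) := by
      rw [div_pow, one_pow, ← div_eq_mul_one_div,
        div_le_div_iff₀ (by positivity) (by positivity), one_mul, ← mul_pow]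
      exact pow_le_pow_left₀ hN.le hRm (d + 1)
    calc Cρ / mR ^ (d + 1) * Real.exp (δ₀' * 3)
        = Cρ * Real.exp (δ₀' * 3) * (1 / mR ^ (d + 1)) := by ring
      _ ≤ Cρ * Real.exp (δ₀' * 3) * (R ^ (d + 1) * (1 / N) ^ (d + 1)) :=
          mul_le_mul_of_nonneg_left h1 (by positivity)
      _ = Cρ * Real.exp (δ₀' * 3) * R ^ (d + 1) * (1 / N) ^ (d + 1) := by ring
  · have h1 : (1 / N) * mR ≤ 1 := by
      rw [one_div_mul_eq_div, div_le_one hN]; exact hmN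
    have hNd : (1 / N) ^ d = (N ^ d)⁻¹ := by rw [div_pow, one_pow, one_div]
    have e : (1 / N) ^ 2 * (CK * (CQ * mR) / N ^ d * Real.exp (δ₀' * 4)
          + a * (CQ * mR) / N ^ d * Real.exp (δ₀' * 5))
        = ((1 / N) * mR) *
          ((CK * CQ * Real.exp (δ₀' * 4) + a * CQ * Real.exp (δ₀' * 5)) * (1 / N) ^ (d + 1)) := by
      rw [pow_succ (1 / N) d, hNd]; ring
    rw [e]
    calc ((1 / N) * mR) *
          ((CK * CQ * Real.exp (δ₀' * 4) + a * CQ * Real.exp (δ₀' * 5)) * (1 / N) ^ (d + 1))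
        ≤ 1 * ((CK * CQ * Real.exp (δ₀' * 4) + a * CQ * Real.exp (δ₀' * 5)) *
            (1 / N) ^ (d + 1)) :=
          mul_le_mul_of_nonneg_right h1 (by positivity)
      _ = _ := one_mul _

end DipoleProfile

/-! ## §5 The source-bond difference and the mixed difference PER BASE POINT -/

section DipoleAssembly

open Literature.MathematicalPhysics.QuantumFieldTheory.Balaban1983to89.Beta.PoissonInterior

variable {d : ℕ} {ι : Type} (nOf : ι → ℕ) [hn0 : ∀ i, NeZero (nOf i)] (hn1 : ∀ i, 1 ≤ nOf i)
  (MOf : ι → Fin d → ℕ) [hM0 : ∀ i μ, NeZero (MOf i μ)] (a : ℝ) (ha : 0 < a)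

/-- **THE SOURCE-BOND DIFFERENCE OF THE COVARIANT PROPAGATOR, PER BASE POINT.**  For `d ≥ 3` and
a ratio bound `R ≥ 1`: ASSUMING [B5, (1.110)–(1.114)] for the reading `fam` and
[B5, (1.126)–(1.127)] for the reading `kfam` (both BY NAME, never discharged here), there are
`δ > 0`, `A ≥ 0` — free of the instance, of the bonds and of `m` — such that for every instance,
every cutoff radius `m` with `1 ≤ m ≤ n ≤ R m`, `6m + 6 ≤ n M_μ`, and all bonds,
`|𝒢((x,κ),(x₀+e_μ,ν₀)) − 𝒢((x,κ),(x₀,ν₀))| ≤ A η² e^{-(δ/n)‖v‖_∞} / max(1,‖v‖_∞)^{d-1}`,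
`v = liftZ (x − x₀)`: ONE POWER BETTER than the value leg `VectorTailsLoc.entry_bound`, by the
dipole parametrix (no translated point residuals are differenced). [folklore] -/
theorem entry_srcDiff_bound (hd : 3 ≤ d) {R : ℝ} (hR : 1 ≤ R)
    (h12 : B5.Prop12Printed (fam nOf hn1 MOf a ha))
    (h126 : B5.Kernel126_127Printed (kfam nOf MOf)) :
    ∃ δ A : ℝ, 0 < δ ∧ 0 ≤ A ∧ ∀ (i : ι) (m : ℕ), 1 ≤ m → m ≤ nOf i →
      ((nOf i : ℕ) : ℝ) ≤ R * m → (∀ μ, 6 * m + 6 ≤ fine (nOf i) (MOf i) μ) →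
      ∀ (x x₀ : Tor (fine (nOf i) (MOf i))) (κ ν₀ μ : Fin d),
        ‖calG (nOf i) (hn1 i) (MOf i) a ha (x, κ) (x₀ + unitVec (fine (nOf i) (MOf i)) μ, ν₀)
            - calG (nOf i) (hn1 i) (MOf i) a ha (x, κ) (x₀, ν₀)‖ ≤
          A * (1 / ((nOf i : ℕ) : ℝ)) ^ 2 *
            Real.exp (-(δ / ((nOf i : ℕ) : ℝ)) * (tdist x₀ x : ℝ)) /
              nrm (liftZ (x - x₀)) ^ (d - 1) := by
  obtain ⟨δ₀, C, hδ₀, hC, hloc⟩ := locBound_of_prop12 nOf hn1 MOf a ha h12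
  obtain ⟨δ₀', CK, hδ₀', hCK, hK⟩ := dPd_bound_of_kernel126 nOf MOf h126
  obtain ⟨Cρ, hCρ, hρ⟩ := abs_dresT_le (d := d) hd
  obtain ⟨CQ, hCQ, hQ⟩ := sum_abs_dparT_le (d := d) hd
  obtain ⟨C₀, hC₀, hpar⟩ := abs_dparT_le (d := d) hd
  obtain ⟨S, hS0, hS⟩ := sum_exp_tdist_le (d := d) (by omega) (half_pos hδ₀)
  have hδ₁pos : 0 < min (δ₀ / 2) δ₀' := lt_min (half_pos hδ₀) hδ₀'
  refine ⟨min (δ₀ / 2) δ₀' / 2, C₀ * Real.exp (3 * (min (δ₀ / 2) δ₀' / 2)) +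
      C * S * Real.exp (min (δ₀ / 2) δ₀') *
        ((Cρ * Real.exp (δ₀' * 3) * R ^ (d + 1) + (CK * CQ * Real.exp (δ₀' * 4)
          + a * CQ * Real.exp (δ₀' * 5))) *
          (1 + (((d + 1 - 2 : ℕ) : ℝ) / (min (δ₀ / 2) δ₀' / 2)) ^ (d + 1 - 2))),
    half_pos hδ₁pos, by positivity, ?_⟩
  intro i m hm hmn hRm hNm x x₀ κ ν₀ μ
  have hnpos : (0 : ℝ) < ((nOf i : ℕ) : ℝ) := Nat.cast_pos.mpr (NeZero.pos _)
  have hn1' : (1 : ℝ) ≤ ((nOf i : ℕ) : ℝ) := by exact_mod_cast hn1 i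
  have hmpos : (0 : ℝ) < (m : ℝ) := by exact_mod_cast hm
  have hmn' : (m : ℝ) ≤ ((nOf i : ℕ) : ℝ) := by exact_mod_cast hmn
  -- Step 1: the abstract bound from the dipole identity
  have hdist : ∀ a b : Tor (MOf i), (0 : ℝ) ≤ (tdist a b : ℝ) := fun a b => Nat.cast_nonneg _
  have htri : ∀ a b c : Tor (MOf i), (tdist a c : ℝ) ≤ (tdist a b : ℝ) + (tdist b c : ℝ) :=
    fun a b c => by exact_mod_cast tdist_triangle a b c
  have hsuppP : ∀ x', dparT m μ x₀ x' ≠ 0 →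
      liftZ (x' - x₀) ∈ cube (0 : Fin d → ℤ) (3 * m - 1) :=
    fun x' hx' => by by_contra h; exact hx' (dparT_eq_zero_of_not_mem hm μ h)
  have hsuppR : ∀ x', dresT m μ x₀ x' ≠ 0 →
      liftZ (x' - x₀) ∈ cube (0 : Fin d → ℤ) (3 * m) :=
    fun x' hx' => by by_contra h; exact hx' (dresT_eq_zero_of_not_mem hm μ h)
  have hsumP : ∑ x', |dparT m μ x₀ x'| ≤ CQ * (m : ℝ) := hQ (fine (nOf i) (MOf i)) m hm μ x₀
  have hVh : ∀ y' : Tor (MOf i),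
      ‖restrictBlk (fun p : Tor (fine (nOf i) (MOf i)) × Fin d =>
          B5Blocks16.blockOf (nOf i) (MOf i) p.1)
          (Vop (nOf i) (MOf i) a *ᵥ colDpar (nOf i) (MOf i) m μ x₀ ν₀) y'‖ ≤
        (CK * (CQ * (m : ℝ)) / ((nOf i : ℕ) : ℝ) ^ d * Real.exp (δ₀' * 4)
          + a * (CQ * (m : ℝ)) / ((nOf i : ℕ) : ℝ) ^ d * Real.exp (δ₀' * 5)) *
          Real.exp (-(δ₀' * (tdist y' (B5Blocks16.blockOf (nOf i) (MOf i) x₀) : ℝ))) := by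
    intro y'
    rw [colDpar, Vop_eq, Matrix.add_mulVec, Matrix.neg_mulVec, restrictBlk_add, restrictBlk_neg,
      add_mul]
    refine (norm_add_le _ _).trans (add_le_add ?_ ?_)
    · rw [norm_neg]
      exact dPd_col_envelope (nOf i) (MOf i) hCK.le hδ₀'.le (hK i) hmn (by positivity) hsumP
        hsuppP ν₀ y'
    · exact aQQ_col_envelope (nOf i) (MOf i) ha.le hmn (by positivity) hsumP hsuppP ν₀
        hδ₀'.le y'
  have hρ' : ∀ y' : Tor (MOf i),
      ‖restrictBlk (fun p : Tor (fine (nOf i) (MOf i)) × Fin d =>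
          B5Blocks16.blockOf (nOf i) (MOf i) p.1) (colDres (nOf i) (MOf i) m μ x₀ ν₀) y'‖ ≤
        Cρ / (m : ℝ) ^ (d + 1) * Real.exp (δ₀' * 3) *
          Real.exp (-(δ₀' * (tdist y' (B5Blocks16.blockOf (nOf i) (MOf i) x₀) : ℝ))) :=
    fun y' => col_envelope (nOf i) (MOf i) hmn (by positivity)
      (fun x' => hρ (fine (nOf i) (MOf i)) m hm μ x₀ x') hsuppR ν₀ hδ₀'.le y'
  have hid := calG_entry_diff_eq (nOf i) (MOf i) a (hn1 i) ha hd hm hNm μ x₀ ν₀ (x, κ)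
  have main := norm_le_of_identity hid (hloc i).1 hC.le hdist htri hδ₀.le hδ₀'.le
    (fun y => hS (MOf i) y) (by positivity) (by positivity) hρ' hVh
  have hnorm_c : ‖((nOf i : ℕ) : ℂ) ^ 2‖⁻¹ = (1 / ((nOf i : ℕ) : ℝ)) ^ 2 := by
    rw [norm_pow, Complex.norm_natCast, one_div, inv_pow]
  rw [hnorm_c] at main
  -- names
  have hrsup : (tdist x₀ x : ℝ) = (supNorm (liftZ (x - x₀)) : ℝ) := rfl
  have hρn : nrm (liftZ (x - x₀)) = max 1 (tdist x₀ x : ℝ) := rfl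
  have hr01 : (tdist x₀ x : ℝ) = 0 ∨ 1 ≤ (tdist x₀ x : ℝ) := by
    rcases Nat.eq_zero_or_pos (tdist x₀ x) with h0 | hpos
    · left; exact_mod_cast h0
    · right; exact_mod_cast hpos
  -- Step 2: the singular part (the dipole parametrix itself)
  have sing : (1 / ((nOf i : ℕ) : ℝ)) ^ 2 * ‖colDpar (nOf i) (MOf i) m μ x₀ ν₀ (x, κ)‖ ≤
      C₀ * Real.exp (3 * (min (δ₀ / 2) δ₀' / 2)) * (1 / ((nOf i : ℕ) : ℝ)) ^ 2 *
        Real.exp (-(min (δ₀ / 2) δ₀' / 2 / ((nOf i : ℕ) : ℝ)) * (tdist x₀ x : ℝ)) /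
          nrm (liftZ (x - x₀)) ^ (d - 1) := by
    have hρpos : 0 < nrm (liftZ (x - x₀)) := nrm_pos _
    by_cases hpx : dparT m μ x₀ x = 0
    · have : colDpar (nOf i) (MOf i) m μ x₀ ν₀ (x, κ) = 0 := by
        rw [colDpar, colOf_apply]; simp [hpx]
      rw [this, norm_zero, mul_zero]
      positivity
    · have h1 : ‖colDpar (nOf i) (MOf i) m μ x₀ ν₀ (x, κ)‖ ≤
          C₀ / nrm (liftZ (x - x₀)) ^ (d - 1) :=
        (norm_colOf_le (nOf i) (MOf i) _ ν₀ (x, κ)).trans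
          (hpar (fine (nOf i) (MOf i)) m hm μ x₀ x)
      have h2 : liftZ (x - x₀) ∈ cube (0 : (Fin d → ℤ)) (3 * m - 1) := hsuppP x hpx
      have h3 : (tdist x₀ x : ℝ) ≤ 3 * ((nOf i : ℕ) : ℝ) := by
        have := (mem_cube_zero_iff.mp h2).trans ((Nat.sub_le _ _).trans
          (Nat.mul_le_mul_left 3 hmn))
        rw [hrsup]; exact_mod_cast this
      have h4 : Real.exp (-(3 * (min (δ₀ / 2) δ₀' / 2))) ≤
          Real.exp (-(min (δ₀ / 2) δ₀' / 2 / ((nOf i : ℕ) : ℝ)) * (tdist x₀ x : ℝ)) := by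
        refine Real.exp_le_exp.mpr ?_
        have e1 : min (δ₀ / 2) δ₀' / 2 / ((nOf i : ℕ) : ℝ) * (tdist x₀ x : ℝ) ≤
            min (δ₀ / 2) δ₀' / 2 / ((nOf i : ℕ) : ℝ) * (3 * ((nOf i : ℕ) : ℝ)) :=
          mul_le_mul_of_nonneg_left h3 (by positivity)
        have e2 : min (δ₀ / 2) δ₀' / 2 / ((nOf i : ℕ) : ℝ) * (3 * ((nOf i : ℕ) : ℝ)) =
            3 * (min (δ₀ / 2) δ₀' / 2) := by field_simp
        rw [neg_mul]
        exact neg_le_neg (e1.trans_eq e2)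
      calc (1 / ((nOf i : ℕ) : ℝ)) ^ 2 * ‖colDpar (nOf i) (MOf i) m μ x₀ ν₀ (x, κ)‖
          ≤ (1 / ((nOf i : ℕ) : ℝ)) ^ 2 * (C₀ / nrm (liftZ (x - x₀)) ^ (d - 1)) :=
            mul_le_mul_of_nonneg_left h1 (by positivity)
        _ = C₀ * (Real.exp (3 * (min (δ₀ / 2) δ₀' / 2)) * Real.exp (-(3 * (min (δ₀ / 2) δ₀' / 2))))
              * (1 / ((nOf i : ℕ) : ℝ)) ^ 2 / nrm (liftZ (x - x₀)) ^ (d - 1) := by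
            rw [← Real.exp_add, add_neg_cancel, Real.exp_zero]; ring
        _ ≤ C₀ * (Real.exp (3 * (min (δ₀ / 2) δ₀' / 2)) *
              Real.exp (-(min (δ₀ / 2) δ₀' / 2 / ((nOf i : ℕ) : ℝ)) * (tdist x₀ x : ℝ)))
              * (1 / ((nOf i : ℕ) : ℝ)) ^ 2 / nrm (liftZ (x - x₀)) ^ (d - 1) := by
            gcongr
        _ = _ := by ring
  -- Step 3: the remainder constants are `≤ B η^{d+1}`; block decay ⇒ fine decay
  have hKsum := dipole_consts_le d (δ₀' := δ₀') hnpos hmpos hmn' hRm hCρ hCK.le hCQ ha.le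
  have hblk := exp_block_le_exp_fine (nOf i) (MOf i) hδ₁pos.le x x₀
  -- Step 4: the remainder in profile form
  have rem := remainder_profile (d := d + 1) (by omega) (B := C * S * Real.exp (min (δ₀ / 2) δ₀') *
      (Cρ * Real.exp (δ₀' * 3) * R ^ (d + 1) + (CK * CQ * Real.exp (δ₀' * 4)
        + a * CQ * Real.exp (δ₀' * 5)))) hδ₁pos hn1' (by positivity) hr01
  rw [← hρn, show d + 1 - 2 = d - 1 by omega] at rem
  have rem0 : C * S * (Cρ / (m : ℝ) ^ (d + 1) * Real.exp (δ₀' * 3) +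
        (1 / ((nOf i : ℕ) : ℝ)) ^ 2 *
        (CK * (CQ * (m : ℝ)) / ((nOf i : ℕ) : ℝ) ^ d * Real.exp (δ₀' * 4)
          + a * (CQ * (m : ℝ)) / ((nOf i : ℕ) : ℝ) ^ d * Real.exp (δ₀' * 5))) *
      Real.exp (-(min (δ₀ / 2) δ₀' *
        (tdist (B5Blocks16.blockOf (nOf i) (MOf i) x) (B5Blocks16.blockOf (nOf i) (MOf i) x₀) : ℝ)))
      ≤ C * S * Real.exp (min (δ₀ / 2) δ₀') *
          (Cρ * Real.exp (δ₀' * 3) * R ^ (d + 1) + (CK * CQ * Real.exp (δ₀' * 4)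
            + a * CQ * Real.exp (δ₀' * 5))) * (1 / ((nOf i : ℕ) : ℝ)) ^ (d + 1) *
          Real.exp (-(min (δ₀ / 2) δ₀' * (tdist x₀ x : ℝ) / ((nOf i : ℕ) : ℝ))) := by
    calc C * S * (Cρ / (m : ℝ) ^ (d + 1) * Real.exp (δ₀' * 3) +
          (1 / ((nOf i : ℕ) : ℝ)) ^ 2 *
          (CK * (CQ * (m : ℝ)) / ((nOf i : ℕ) : ℝ) ^ d * Real.exp (δ₀' * 4)
            + a * (CQ * (m : ℝ)) / ((nOf i : ℕ) : ℝ) ^ d * Real.exp (δ₀' * 5))) *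
          Real.exp (-(min (δ₀ / 2) δ₀' *
            (tdist (B5Blocks16.blockOf (nOf i) (MOf i) x)
              (B5Blocks16.blockOf (nOf i) (MOf i) x₀) : ℝ)))
        ≤ C * S * ((Cρ * Real.exp (δ₀' * 3) * R ^ (d + 1) + (CK * CQ * Real.exp (δ₀' * 4)
            + a * CQ * Real.exp (δ₀' * 5))) * (1 / ((nOf i : ℕ) : ℝ)) ^ (d + 1)) *
            (Real.exp (min (δ₀ / 2) δ₀') *
              Real.exp (-(min (δ₀ / 2) δ₀' * (tdist x₀ x : ℝ) / ((nOf i : ℕ) : ℝ)))) :=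
          mul_le_mul (mul_le_mul_of_nonneg_left hKsum (by positivity)) hblk (by positivity)
            (by positivity)
      _ = _ := by ring
  -- Step 5: assemble
  refine (main.trans (add_le_add sing (rem0.trans rem))).trans (le_of_eq ?_)
  rw [show d + 1 - 2 = d - 1 by omega]
  ring

/-- **THE MIXED DIFFERENCE (observation bond AND source bond), PER BASE POINT.**  Same
hypotheses as `entry_srcDiff_bound`; conclusion
`|[𝒢((x+e_{μ'},κ),·) − 𝒢((x,κ),·)]((x₀+e_μ,ν₀)) − […]((x₀,ν₀))|
   ≤ A η² e^{-(δ/n)‖v‖_∞} / max(1,‖v‖_∞)^d` — TWO POWERS BETTER than the value leg (the shifted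
difference of `𝒢` in the observation variable has (1.110)-constant `C η` by
`VectorTailsLoc.locBound_shiftDiff`, and the dipole parametrix difference is `O(nrm^{-d})` by
`abs_dparT_diff_le`). [folklore] -/
theorem entry_mixed_bound (hd : 3 ≤ d) {R : ℝ} (hR : 1 ≤ R)
    (h12 : B5.Prop12Printed (fam nOf hn1 MOf a ha))
    (h126 : B5.Kernel126_127Printed (kfam nOf MOf)) :
    ∃ δ A : ℝ, 0 < δ ∧ 0 ≤ A ∧ ∀ (i : ι) (m : ℕ), 1 ≤ m → m ≤ nOf i →
      ((nOf i : ℕ) : ℝ) ≤ R * m → (∀ μ, 6 * m + 6 ≤ fine (nOf i) (MOf i) μ) →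
      ∀ (x x₀ : Tor (fine (nOf i) (MOf i))) (κ ν₀ μ μ' : Fin d),
        ‖(calG (nOf i) (hn1 i) (MOf i) a ha (x + unitVec (fine (nOf i) (MOf i)) μ', κ)
              (x₀ + unitVec (fine (nOf i) (MOf i)) μ, ν₀)
            - calG (nOf i) (hn1 i) (MOf i) a ha (x, κ) (x₀ + unitVec (fine (nOf i) (MOf i)) μ, ν₀))
          - (calG (nOf i) (hn1 i) (MOf i) a ha (x + unitVec (fine (nOf i) (MOf i)) μ', κ) (x₀, ν₀)
            - calG (nOf i) (hn1 i) (MOf i) a ha (x, κ) (x₀, ν₀))‖ ≤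
          A * (1 / ((nOf i : ℕ) : ℝ)) ^ 2 *
            Real.exp (-(δ / ((nOf i : ℕ) : ℝ)) * (tdist x₀ x : ℝ)) /
              nrm (liftZ (x - x₀)) ^ d := by
  obtain ⟨δ₀, C, hδ₀, hC, hloc⟩ := locBound_of_prop12 nOf hn1 MOf a ha h12
  obtain ⟨δ₀', CK, hδ₀', hCK, hK⟩ := dPd_bound_of_kernel126 nOf MOf h126
  obtain ⟨Cρ, hCρ, hρ⟩ := abs_dresT_le (d := d) hd
  obtain ⟨CQ, hCQ, hQ⟩ := sum_abs_dparT_le (d := d) hd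
  obtain ⟨C₀, hC₀, hpar⟩ := abs_dparT_diff_le (d := d) hd
  obtain ⟨S, hS0, hS⟩ := sum_exp_tdist_le (d := d) (by omega) (half_pos hδ₀)
  have hδ₁pos : 0 < min (δ₀ / 2) δ₀' := lt_min (half_pos hδ₀) hδ₀'
  refine ⟨min (δ₀ / 2) δ₀' / 2, C₀ * Real.exp (4 * (min (δ₀ / 2) δ₀' / 2)) +
      C * S * Real.exp (min (δ₀ / 2) δ₀') *
        ((Cρ * Real.exp (δ₀' * 3) * R ^ (d + 1) + (CK * CQ * Real.exp (δ₀' * 4)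
          + a * CQ * Real.exp (δ₀' * 5))) *
          (1 + (((d + 2 - 2 : ℕ) : ℝ) / (min (δ₀ / 2) δ₀' / 2)) ^ (d + 2 - 2))),
    half_pos hδ₁pos, by positivity, ?_⟩
  intro i m hm hmn hRm hNm x x₀ κ ν₀ μ μ'
  have hnpos : (0 : ℝ) < ((nOf i : ℕ) : ℝ) := Nat.cast_pos.mpr (NeZero.pos _)
  have hn1' : (1 : ℝ) ≤ ((nOf i : ℕ) : ℝ) := by exact_mod_cast hn1 i
  have hmpos : (0 : ℝ) < (m : ℝ) := by exact_mod_cast hm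
  have hmn' : (m : ℝ) ≤ ((nOf i : ℕ) : ℝ) := by exact_mod_cast hmn
  -- Step 1: the abstract bound for the shifted difference of the dipole identity
  have hdist : ∀ a b : Tor (MOf i), (0 : ℝ) ≤ (tdist a b : ℝ) := fun a b => Nat.cast_nonneg _
  have htri : ∀ a b c : Tor (MOf i), (tdist a c : ℝ) ≤ (tdist a b : ℝ) + (tdist b c : ℝ) :=
    fun a b c => by exact_mod_cast tdist_triangle a b c
  have hsuppP : ∀ x', dparT m μ x₀ x' ≠ 0 →
      liftZ (x' - x₀) ∈ cube (0 : Fin d → ℤ) (3 * m - 1) :=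
    fun x' hx' => by by_contra h; exact hx' (dparT_eq_zero_of_not_mem hm μ h)
  have hsuppR : ∀ x', dresT m μ x₀ x' ≠ 0 →
      liftZ (x' - x₀) ∈ cube (0 : Fin d → ℤ) (3 * m) :=
    fun x' hx' => by by_contra h; exact hx' (dresT_eq_zero_of_not_mem hm μ h)
  have hsumP : ∑ x', |dparT m μ x₀ x'| ≤ CQ * (m : ℝ) := hQ (fine (nOf i) (MOf i)) m hm μ x₀
  have hVh : ∀ y' : Tor (MOf i),
      ‖restrictBlk (fun p : Tor (fine (nOf i) (MOf i)) × Fin d =>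
          B5Blocks16.blockOf (nOf i) (MOf i) p.1)
          (Vop (nOf i) (MOf i) a *ᵥ colDpar (nOf i) (MOf i) m μ x₀ ν₀) y'‖ ≤
        (CK * (CQ * (m : ℝ)) / ((nOf i : ℕ) : ℝ) ^ d * Real.exp (δ₀' * 4)
          + a * (CQ * (m : ℝ)) / ((nOf i : ℕ) : ℝ) ^ d * Real.exp (δ₀' * 5)) *
          Real.exp (-(δ₀' * (tdist y' (B5Blocks16.blockOf (nOf i) (MOf i) x₀) : ℝ))) := by
    intro y'
    rw [colDpar, Vop_eq, Matrix.add_mulVec, Matrix.neg_mulVec, restrictBlk_add, restrictBlk_neg,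
      add_mul]
    refine (norm_add_le _ _).trans (add_le_add ?_ ?_)
    · rw [norm_neg]
      exact dPd_col_envelope (nOf i) (MOf i) hCK.le hδ₀'.le (hK i) hmn (by positivity) hsumP
        hsuppP ν₀ y'
    · exact aQQ_col_envelope (nOf i) (MOf i) ha.le hmn (by positivity) hsumP hsuppP ν₀
        hδ₀'.le y'
  have hρ' : ∀ y' : Tor (MOf i),
      ‖restrictBlk (fun p : Tor (fine (nOf i) (MOf i)) × Fin d =>
          B5Blocks16.blockOf (nOf i) (MOf i) p.1) (colDres (nOf i) (MOf i) m μ x₀ ν₀) y'‖ ≤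
        Cρ / (m : ℝ) ^ (d + 1) * Real.exp (δ₀' * 3) *
          Real.exp (-(δ₀' * (tdist y' (B5Blocks16.blockOf (nOf i) (MOf i) x₀) : ℝ))) :=
    fun y' => col_envelope (nOf i) (MOf i) hmn (by positivity)
      (fun x' => hρ (fine (nOf i) (MOf i)) m hm μ x₀ x') hsuppR ν₀ hδ₀'.le y'
  have hid := shiftDiff_calG_entry_diff_eq (nOf i) (MOf i) a (hn1 i) ha hd hm hNm μ x₀ ν₀ μ'
    (x, κ)
  have main := norm_le_of_identity hid
    (locBound_shiftDiff (nOf i) (MOf i) (hn1 i) a ha (hloc i).2 μ')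
    (div_nonneg hC.le hnpos.le) hdist htri hδ₀.le hδ₀'.le (fun y => hS (MOf i) y)
    (by positivity) (by positivity) hρ' hVh
  have hnorm_c : ‖((nOf i : ℕ) : ℂ) ^ 2‖⁻¹ = (1 / ((nOf i : ℕ) : ℝ)) ^ 2 := by
    rw [norm_pow, Complex.norm_natCast, one_div, inv_pow]
  rw [hnorm_c] at main
  have hlhs : ∀ q : Tor (fine (nOf i) (MOf i)) × Fin d,
      shiftDiff (calG (nOf i) (hn1 i) (MOf i) a ha) μ' (x, κ) q =
        calG (nOf i) (hn1 i) (MOf i) a ha (x + unitVec (fine (nOf i) (MOf i)) μ', κ) q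
          - calG (nOf i) (hn1 i) (MOf i) a ha (x, κ) q := fun q => rfl
  rw [hlhs, hlhs] at main
  -- names
  have hrsup : (tdist x₀ x : ℝ) = (supNorm (liftZ (x - x₀)) : ℝ) := rfl
  have hρn : nrm (liftZ (x - x₀)) = max 1 (tdist x₀ x : ℝ) := rfl
  have hr01 : (tdist x₀ x : ℝ) = 0 ∨ 1 ≤ (tdist x₀ x : ℝ) := by
    rcases Nat.eq_zero_or_pos (tdist x₀ x) with h0 | hpos
    · left; exact_mod_cast h0
    · right; exact_mod_cast hpos
  -- Step 2: the singular part (the dipole-parametrix difference)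
  have sing : (1 / ((nOf i : ℕ) : ℝ)) ^ 2 *
      ‖colDpar (nOf i) (MOf i) m μ x₀ ν₀ ((x, κ).1 + unitVec (fine (nOf i) (MOf i)) μ', (x, κ).2)
        - colDpar (nOf i) (MOf i) m μ x₀ ν₀ (x, κ)‖ ≤
      C₀ * Real.exp (4 * (min (δ₀ / 2) δ₀' / 2)) * (1 / ((nOf i : ℕ) : ℝ)) ^ 2 *
        Real.exp (-(min (δ₀ / 2) δ₀' / 2 / ((nOf i : ℕ) : ℝ)) * (tdist x₀ x : ℝ)) /
          nrm (liftZ (x - x₀)) ^ d := by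
    have hρpos : 0 < nrm (liftZ (x - x₀)) := nrm_pos _
    by_cases hmem : liftZ (x - x₀) ∈ cube (0 : (Fin d → ℤ)) (3 * m + 1)
    · have h1 : ‖colDpar (nOf i) (MOf i) m μ x₀ ν₀ (x + unitVec (fine (nOf i) (MOf i)) μ', κ)
          - colDpar (nOf i) (MOf i) m μ x₀ ν₀ (x, κ)‖ ≤ C₀ / nrm (liftZ (x - x₀)) ^ d :=
        (norm_colOf_sub_le (nOf i) (MOf i) _ ν₀ x _ κ).trans
          (hpar (fine (nOf i) (MOf i)) m hm hNm μ x₀ x μ' hmem)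
      have h3 : (tdist x₀ x : ℝ) ≤ 4 * ((nOf i : ℕ) : ℝ) := by
        have := mem_cube_zero_iff.mp hmem
        have h' : ((supNorm (liftZ (x - x₀)) : ℕ) : ℝ) ≤ 3 * (m : ℝ) + 1 := by exact_mod_cast this
        rw [hrsup]; linarith only [h', hmn', hn1']
      have h4 : Real.exp (-(4 * (min (δ₀ / 2) δ₀' / 2))) ≤
          Real.exp (-(min (δ₀ / 2) δ₀' / 2 / ((nOf i : ℕ) : ℝ)) * (tdist x₀ x : ℝ)) := by
        refine Real.exp_le_exp.mpr ?_
        have e1 : min (δ₀ / 2) δ₀' / 2 / ((nOf i : ℕ) : ℝ) * (tdist x₀ x : ℝ) ≤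
            min (δ₀ / 2) δ₀' / 2 / ((nOf i : ℕ) : ℝ) * (4 * ((nOf i : ℕ) : ℝ)) :=
          mul_le_mul_of_nonneg_left h3 (by positivity)
        have e2 : min (δ₀ / 2) δ₀' / 2 / ((nOf i : ℕ) : ℝ) * (4 * ((nOf i : ℕ) : ℝ)) =
            4 * (min (δ₀ / 2) δ₀' / 2) := by field_simp
        rw [neg_mul]
        exact neg_le_neg (e1.trans_eq e2)
      calc (1 / ((nOf i : ℕ) : ℝ)) ^ 2 *
            ‖colDpar (nOf i) (MOf i) m μ x₀ ν₀ (x + unitVec (fine (nOf i) (MOf i)) μ', κ)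
              - colDpar (nOf i) (MOf i) m μ x₀ ν₀ (x, κ)‖
          ≤ (1 / ((nOf i : ℕ) : ℝ)) ^ 2 * (C₀ / nrm (liftZ (x - x₀)) ^ d) :=
            mul_le_mul_of_nonneg_left h1 (by positivity)
        _ = C₀ * (Real.exp (4 * (min (δ₀ / 2) δ₀' / 2)) *
              Real.exp (-(4 * (min (δ₀ / 2) δ₀' / 2))))
              * (1 / ((nOf i : ℕ) : ℝ)) ^ 2 / nrm (liftZ (x - x₀)) ^ d := by
            rw [← Real.exp_add, add_neg_cancel, Real.exp_zero]; ring
        _ ≤ C₀ * (Real.exp (4 * (min (δ₀ / 2) δ₀' / 2)) *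
              Real.exp (-(min (δ₀ / 2) δ₀' / 2 / ((nOf i : ℕ) : ℝ)) * (tdist x₀ x : ℝ)))
              * (1 / ((nOf i : ℕ) : ℝ)) ^ 2 / nrm (liftZ (x - x₀)) ^ d := by
            gcongr
        _ = _ := by ring
    · -- off the `(3m+1)`-cube both dipole-parametrix values vanish
      have h0 : dparT m μ x₀ x = 0 :=
        dparT_eq_zero_of_not_mem hm μ (fun h' => hmem (cube_mono (by omega) h'))
      have h0' : dparT m μ x₀ (x + unitVec (fine (nOf i) (MOf i)) μ') = 0 := by
        refine dparT_eq_zero_of_not_mem hm μ ?_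
        have e1 : x + unitVec (fine (nOf i) (MOf i)) μ' - x₀ =
            (x - x₀) + castT (fine (nOf i) (MOf i)) (Pi.single μ' 1) := by
          rw [castT_single]; show x + Pi.single μ' 1 - x₀ = x - x₀ + Pi.single μ' 1; abel
        rw [e1]
        have hmem' : liftZ (x - x₀) ∉ cube (0 : (Fin d → ℤ)) (3 * m - 1 + 2) := by
          rwa [show 3 * m - 1 + 2 = 3 * m + 1 by omega]
        exact liftZ_add_castT_not_mem hmem'
          (fun ν => by have := hNm ν; rw [fine] at this ⊢; omega) (supNorm_single_one μ')
      have : colDpar (nOf i) (MOf i) m μ x₀ ν₀ (x + unitVec (fine (nOf i) (MOf i)) μ', κ)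
          - colDpar (nOf i) (MOf i) m μ x₀ ν₀ (x, κ) = 0 := by
        simp only [colDpar, colOf_apply, h0, h0']
        split_ifs <;> simp
      rw [this, norm_zero, mul_zero]
      positivity
  -- Step 3: constants and block ⇒ fine decay
  have hKsum := dipole_consts_le d (δ₀' := δ₀') hnpos hmpos hmn' hRm hCρ hCK.le hCQ ha.le
  have hblk := exp_block_le_exp_fine (nOf i) (MOf i) hδ₁pos.le x x₀
  -- Step 4: the remainder in profile form, two powers of `η` better than the value leg
  have rem := remainder_profile (d := d + 2) (by omega) (B := C * S * Real.exp (min (δ₀ / 2) δ₀') *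
      (Cρ * Real.exp (δ₀' * 3) * R ^ (d + 1) + (CK * CQ * Real.exp (δ₀' * 4)
        + a * CQ * Real.exp (δ₀' * 5)))) hδ₁pos hn1' (by positivity) hr01
  rw [← hρn, show d + 2 - 2 = d by omega] at rem
  have rem0 : C / ((nOf i : ℕ) : ℝ) * S * (Cρ / (m : ℝ) ^ (d + 1) * Real.exp (δ₀' * 3) +
        (1 / ((nOf i : ℕ) : ℝ)) ^ 2 *
        (CK * (CQ * (m : ℝ)) / ((nOf i : ℕ) : ℝ) ^ d * Real.exp (δ₀' * 4)
          + a * (CQ * (m : ℝ)) / ((nOf i : ℕ) : ℝ) ^ d * Real.exp (δ₀' * 5))) *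
      Real.exp (-(min (δ₀ / 2) δ₀' *
        (tdist (B5Blocks16.blockOf (nOf i) (MOf i) x) (B5Blocks16.blockOf (nOf i) (MOf i) x₀) : ℝ)))
      ≤ C * S * Real.exp (min (δ₀ / 2) δ₀') *
          (Cρ * Real.exp (δ₀' * 3) * R ^ (d + 1) + (CK * CQ * Real.exp (δ₀' * 4)
            + a * CQ * Real.exp (δ₀' * 5))) * (1 / ((nOf i : ℕ) : ℝ)) ^ (d + 2) *
          Real.exp (-(min (δ₀ / 2) δ₀' * (tdist x₀ x : ℝ) / ((nOf i : ℕ) : ℝ))) := by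
    calc C / ((nOf i : ℕ) : ℝ) * S * (Cρ / (m : ℝ) ^ (d + 1) * Real.exp (δ₀' * 3) +
          (1 / ((nOf i : ℕ) : ℝ)) ^ 2 *
          (CK * (CQ * (m : ℝ)) / ((nOf i : ℕ) : ℝ) ^ d * Real.exp (δ₀' * 4)
            + a * (CQ * (m : ℝ)) / ((nOf i : ℕ) : ℝ) ^ d * Real.exp (δ₀' * 5))) *
          Real.exp (-(min (δ₀ / 2) δ₀' *
            (tdist (B5Blocks16.blockOf (nOf i) (MOf i) x)
              (B5Blocks16.blockOf (nOf i) (MOf i) x₀) : ℝ)))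
        ≤ C / ((nOf i : ℕ) : ℝ) * S * ((Cρ * Real.exp (δ₀' * 3) * R ^ (d + 1)
            + (CK * CQ * Real.exp (δ₀' * 4) + a * CQ * Real.exp (δ₀' * 5))) *
              (1 / ((nOf i : ℕ) : ℝ)) ^ (d + 1)) *
            (Real.exp (min (δ₀ / 2) δ₀') *
              Real.exp (-(min (δ₀ / 2) δ₀' * (tdist x₀ x : ℝ) / ((nOf i : ℕ) : ℝ)))) :=
          mul_le_mul (mul_le_mul_of_nonneg_left hKsum (by positivity)) hblk (by positivity)
            (by positivity)
      _ = _ := by rw [pow_succ (1 / ((nOf i : ℕ) : ℝ)) (d + 1)]; ring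
  -- Step 5: assemble
  refine (main.trans (add_le_add sing (rem0.trans rem))).trans (le_of_eq ?_)
  rw [show d + 2 - 2 = d by omega]
  ring

end DipoleAssembly

/-! ## §6 Bounded `n`, and the dipole legs UNIFORM IN THE INSTANCE -/

section SmallDipole

open Literature.MathematicalPhysics.QuantumFieldTheory.Balaban1983to89.Beta.PoissonInterior

variable {d : ℕ} {ι : Type} (nOf : ι → ℕ) [hn0 : ∀ i, NeZero (nOf i)] (hn1 : ∀ i, 1 ≤ nOf i)
  (MOf : ι → Fin d → ℕ) [hM0 : ∀ i μ, NeZero (MOf i μ)] (a : ℝ) (ha : 0 < a)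

/-- neighbouring fine sites lie in blocks at block distance `≤ 1`. [folklore] -/
theorem tdist_blockOf_add_unitVec_le (n : ℕ) [NeZero n] (M : Fin d → ℕ) [∀ μ, NeZero (M μ)]
    (x₀ : Tor (fine n M)) (μ : Fin d) :
    tdist (B5Blocks16.blockOf n M x₀) (B5Blocks16.blockOf n M (x₀ + unitVec (fine n M) μ))
      ≤ 1 := by
  refine tdist_blockOf_le_of_supNorm_le n M ?_
  have h : tdist x₀ (x₀ + unitVec (fine n M) μ) ≤ 1 := tdist_add_unitVec_le (fine n M) x₀ μ
  have e : supNorm (liftZ (x₀ + unitVec (fine n M) μ - x₀)) =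
      tdist x₀ (x₀ + unitVec (fine n M) μ) := rfl
  rw [e, one_mul]
  exact h.trans NeZero.one_le

/-- block decay about the neighbouring source block costs a factor `e^{δ₀}`. [folklore] -/
theorem exp_block_shift_le (n : ℕ) [NeZero n] (M : Fin d → ℕ) [∀ μ, NeZero (M μ)] {δ₀ : ℝ}
    (hδ₀ : 0 ≤ δ₀) (x x₀ : Tor (fine n M)) (μ : Fin d) :
    Real.exp (-(δ₀ * (tdist (B5Blocks16.blockOf n M x)
        (B5Blocks16.blockOf n M (x₀ + unitVec (fine n M) μ)) : ℝ))) ≤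
      Real.exp δ₀ *
        Real.exp (-(δ₀ * (tdist (B5Blocks16.blockOf n M x) (B5Blocks16.blockOf n M x₀) : ℝ))) := by
  rw [← Real.exp_add]
  refine Real.exp_le_exp.mpr ?_
  have t := tdist_triangle (B5Blocks16.blockOf n M x)
    (B5Blocks16.blockOf n M (x₀ + unitVec (fine n M) μ)) (B5Blocks16.blockOf n M x₀)
  have h1 := tdist_blockOf_add_unitVec_le n M x₀ μ
  rw [tdist_comm] at h1
  have h2 : (tdist (B5Blocks16.blockOf n M x) (B5Blocks16.blockOf n M x₀) : ℝ) ≤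
      (tdist (B5Blocks16.blockOf n M x) (B5Blocks16.blockOf n M (x₀ + unitVec (fine n M) μ)) : ℝ)
        + 1 := by
    exact_mod_cast t.trans (by omega)
  have h3 := mul_le_mul_of_nonneg_left h2 hδ₀
  linarith

/-- **the source-bond difference for BOUNDED `n ≤ N₀` from (1.110) alone** (triangle inequality on
the two point sources; the `η^{-(d+1)}` loss is a constant `≤ N₀^{d+1}`). [folklore] -/
theorem entry_srcDiff_bound_small (hd : 3 ≤ d) (N₀ : ℕ)
    (h12 : B5.Prop12Printed (fam nOf hn1 MOf a ha)) :
    ∃ δ A : ℝ, 0 < δ ∧ 0 ≤ A ∧ ∀ (i : ι), nOf i ≤ N₀ →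
      ∀ (x x₀ : Tor (fine (nOf i) (MOf i))) (κ ν₀ μ : Fin d),
        ‖calG (nOf i) (hn1 i) (MOf i) a ha (x, κ) (x₀ + unitVec (fine (nOf i) (MOf i)) μ, ν₀)
            - calG (nOf i) (hn1 i) (MOf i) a ha (x, κ) (x₀, ν₀)‖ ≤
          A * (1 / ((nOf i : ℕ) : ℝ)) ^ 2 *
            Real.exp (-(δ / ((nOf i : ℕ) : ℝ)) * (tdist x₀ x : ℝ)) /
              nrm (liftZ (x - x₀)) ^ (d - 1) := by
  obtain ⟨δ₀, C, hδ₀, hC, hloc⟩ := locBound_of_prop12 nOf hn1 MOf a ha h12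
  refine ⟨δ₀ / 2, 2 * C * Real.exp δ₀ * Real.exp δ₀ * (N₀ : ℝ) ^ (d + 1) *
      (1 + (((d + 1 - 2 : ℕ) : ℝ) / (δ₀ / 2)) ^ (d + 1 - 2)),
    half_pos hδ₀, by positivity, fun i hN x x₀ κ ν₀ μ => ?_⟩
  have hnpos : (0 : ℝ) < ((nOf i : ℕ) : ℝ) := Nat.cast_pos.mpr (NeZero.pos _)
  have hn1' : (1 : ℝ) ≤ ((nOf i : ℕ) : ℝ) := by exact_mod_cast hn1 i
  have hN' : ((nOf i : ℕ) : ℝ) ≤ (N₀ : ℝ) := by exact_mod_cast hN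
  have hρ : nrm (liftZ (x - x₀)) = max 1 (tdist x₀ x : ℝ) := rfl
  have hr01 : (tdist x₀ x : ℝ) = 0 ∨ 1 ≤ (tdist x₀ x : ℝ) := by
    rcases Nat.eq_zero_or_pos (tdist x₀ x) with h0 | hpos
    · left; exact_mod_cast h0
    · right; exact_mod_cast hpos
  set E := Real.exp (-(δ₀ * (tdist (B5Blocks16.blockOf (nOf i) (MOf i) x)
    (B5Blocks16.blockOf (nOf i) (MOf i) x₀) : ℝ))) with hE
  -- (1.110) on the two point sources
  have hA : ‖calG (nOf i) (hn1 i) (MOf i) a ha (x, κ)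
        (x₀ + unitVec (fine (nOf i) (MOf i)) μ, ν₀)‖ ≤
      C * Real.exp (-(δ₀ * (tdist (B5Blocks16.blockOf (nOf i) (MOf i) x)
        (B5Blocks16.blockOf (nOf i) (MOf i) (x₀ + unitVec (fine (nOf i) (MOf i)) μ)) : ℝ))) := by
    have := (hloc i).1 (Pi.single (x₀ + unitVec (fine (nOf i) (MOf i)) μ, ν₀) 1)
      (B5Blocks16.blockOf (nOf i) (MOf i) (x₀ + unitVec (fine (nOf i) (MOf i)) μ))
      (single_supported (nOf i) (MOf i) _ ν₀) (x, κ)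
    rw [Matrix.mulVec_single_one, Pi.norm_single, norm_one, mul_one] at this
    exact this
  have hB : ‖calG (nOf i) (hn1 i) (MOf i) a ha (x, κ) (x₀, ν₀)‖ ≤ C * E := by
    have := (hloc i).1 (Pi.single (x₀, ν₀) 1) (B5Blocks16.blockOf (nOf i) (MOf i) x₀)
      (single_supported (nOf i) (MOf i) x₀ ν₀) (x, κ)
    rw [Matrix.mulVec_single_one, Pi.norm_single, norm_one, mul_one] at this
    exact this
  have h1 : ‖calG (nOf i) (hn1 i) (MOf i) a ha (x, κ) (x₀ + unitVec (fine (nOf i) (MOf i)) μ, ν₀)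
        - calG (nOf i) (hn1 i) (MOf i) a ha (x, κ) (x₀, ν₀)‖ ≤ 2 * C * Real.exp δ₀ * E := by
    refine (norm_sub_le _ _).trans ?_
    have eA := exp_block_shift_le (nOf i) (MOf i) hδ₀.le x x₀ μ
    have e1 : E ≤ Real.exp δ₀ * E :=
      le_mul_of_one_le_left (Real.exp_nonneg _) (Real.one_le_exp hδ₀.le)
    calc _ ≤ C * (Real.exp δ₀ * E) + C * (Real.exp δ₀ * E) :=
          add_le_add (hA.trans (mul_le_mul_of_nonneg_left eA hC.le))
            (hB.trans (mul_le_mul_of_nonneg_left e1 hC.le))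
      _ = 2 * C * Real.exp δ₀ * E := by ring
  have h2 := exp_block_le_exp_fine (nOf i) (MOf i) hδ₀.le x x₀
  have rem := remainder_profile (d := d + 1) (by omega) (B := (1 : ℝ)) hδ₀ hn1' zero_le_one hr01
  rw [← hρ, one_mul, one_mul, show d + 1 - 2 = d - 1 by omega] at rem
  have hnd : Real.exp (-(δ₀ * (tdist x₀ x : ℝ) / ((nOf i : ℕ) : ℝ))) =
      ((nOf i : ℕ) : ℝ) ^ (d + 1) * ((1 / ((nOf i : ℕ) : ℝ)) ^ (d + 1) *
        Real.exp (-(δ₀ * (tdist x₀ x : ℝ) / ((nOf i : ℕ) : ℝ)))) := by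
    rw [← mul_assoc, ← mul_pow, mul_one_div_cancel hnpos.ne', one_pow, one_mul]
  have hNd : ((nOf i : ℕ) : ℝ) ^ (d + 1) ≤ (N₀ : ℝ) ^ (d + 1) :=
    pow_le_pow_left₀ hnpos.le hN' (d + 1)
  calc ‖calG (nOf i) (hn1 i) (MOf i) a ha (x, κ) (x₀ + unitVec (fine (nOf i) (MOf i)) μ, ν₀)
        - calG (nOf i) (hn1 i) (MOf i) a ha (x, κ) (x₀, ν₀)‖
      ≤ 2 * C * Real.exp δ₀ *
          (Real.exp δ₀ * Real.exp (-(δ₀ * (tdist x₀ x : ℝ) / ((nOf i : ℕ) : ℝ)))) :=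
        h1.trans (mul_le_mul_of_nonneg_left h2 (by positivity))
    _ = 2 * C * Real.exp δ₀ * Real.exp δ₀ * (((nOf i : ℕ) : ℝ) ^ (d + 1) *
          ((1 / ((nOf i : ℕ) : ℝ)) ^ (d + 1) *
            Real.exp (-(δ₀ * (tdist x₀ x : ℝ) / ((nOf i : ℕ) : ℝ))))) := by rw [← hnd]; ring
    _ ≤ 2 * C * Real.exp δ₀ * Real.exp δ₀ * ((N₀ : ℝ) ^ (d + 1) *
          ((1 + (((d + 1 - 2 : ℕ) : ℝ) / (δ₀ / 2)) ^ (d - 1)) *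
          (1 / ((nOf i : ℕ) : ℝ)) ^ 2 * Real.exp (-(δ₀ / 2 / ((nOf i : ℕ) : ℝ)) * (tdist x₀ x : ℝ))
            / nrm (liftZ (x - x₀)) ^ (d - 1))) := by
        refine mul_le_mul_of_nonneg_left (mul_le_mul hNd rem (by positivity) (by positivity))
          (by positivity)
    _ = _ := by rw [show d + 1 - 2 = d - 1 by omega]; ring

/-- **the mixed difference for BOUNDED `n ≤ N₀` from the gradient clause of (1.110) alone.**
[folklore] -/
theorem entry_mixed_bound_small (hd : 3 ≤ d) (N₀ : ℕ)
    (h12 : B5.Prop12Printed (fam nOf hn1 MOf a ha)) :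
    ∃ δ A : ℝ, 0 < δ ∧ 0 ≤ A ∧ ∀ (i : ι), nOf i ≤ N₀ →
      ∀ (x x₀ : Tor (fine (nOf i) (MOf i))) (κ ν₀ μ μ' : Fin d),
        ‖(calG (nOf i) (hn1 i) (MOf i) a ha (x + unitVec (fine (nOf i) (MOf i)) μ', κ)
              (x₀ + unitVec (fine (nOf i) (MOf i)) μ, ν₀)
            - calG (nOf i) (hn1 i) (MOf i) a ha (x, κ) (x₀ + unitVec (fine (nOf i) (MOf i)) μ, ν₀))
          - (calG (nOf i) (hn1 i) (MOf i) a ha (x + unitVec (fine (nOf i) (MOf i)) μ', κ) (x₀, ν₀)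
            - calG (nOf i) (hn1 i) (MOf i) a ha (x, κ) (x₀, ν₀))‖ ≤
          A * (1 / ((nOf i : ℕ) : ℝ)) ^ 2 *
            Real.exp (-(δ / ((nOf i : ℕ) : ℝ)) * (tdist x₀ x : ℝ)) /
              nrm (liftZ (x - x₀)) ^ d := by
  obtain ⟨δ₀, C, hδ₀, hC, hloc⟩ := locBound_of_prop12 nOf hn1 MOf a ha h12
  refine ⟨δ₀ / 2, 2 * C * Real.exp δ₀ * Real.exp δ₀ * (N₀ : ℝ) ^ (d + 1) *
      (1 + (((d + 2 - 2 : ℕ) : ℝ) / (δ₀ / 2)) ^ (d + 2 - 2)),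
    half_pos hδ₀, by positivity, fun i hN x x₀ κ ν₀ μ μ' => ?_⟩
  have hnpos : (0 : ℝ) < ((nOf i : ℕ) : ℝ) := Nat.cast_pos.mpr (NeZero.pos _)
  have hn1' : (1 : ℝ) ≤ ((nOf i : ℕ) : ℝ) := by exact_mod_cast hn1 i
  have hN' : ((nOf i : ℕ) : ℝ) ≤ (N₀ : ℝ) := by exact_mod_cast hN
  have hρ : nrm (liftZ (x - x₀)) = max 1 (tdist x₀ x : ℝ) := rfl
  have hr01 : (tdist x₀ x : ℝ) = 0 ∨ 1 ≤ (tdist x₀ x : ℝ) := by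
    rcases Nat.eq_zero_or_pos (tdist x₀ x) with h0 | hpos
    · left; exact_mod_cast h0
    · right; exact_mod_cast hpos
  set E := Real.exp (-(δ₀ * (tdist (B5Blocks16.blockOf (nOf i) (MOf i) x)
    (B5Blocks16.blockOf (nOf i) (MOf i) x₀) : ℝ))) with hE
  have hlhs : ∀ q : Tor (fine (nOf i) (MOf i)) × Fin d,
      shiftDiff (calG (nOf i) (hn1 i) (MOf i) a ha) μ' (x, κ) q =
        calG (nOf i) (hn1 i) (MOf i) a ha (x + unitVec (fine (nOf i) (MOf i)) μ', κ) q
          - calG (nOf i) (hn1 i) (MOf i) a ha (x, κ) q := fun q => rfl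
  -- the gradient clause of (1.110) on the two point sources
  have hA : ‖shiftDiff (calG (nOf i) (hn1 i) (MOf i) a ha) μ' (x, κ)
        (x₀ + unitVec (fine (nOf i) (MOf i)) μ, ν₀)‖ ≤
      C / ((nOf i : ℕ) : ℝ) * Real.exp (-(δ₀ * (tdist (B5Blocks16.blockOf (nOf i) (MOf i) x)
        (B5Blocks16.blockOf (nOf i) (MOf i) (x₀ + unitVec (fine (nOf i) (MOf i)) μ)) : ℝ))) := by
    have := locBound_shiftDiff (nOf i) (MOf i) (hn1 i) a ha (hloc i).2 μ'
      (Pi.single (x₀ + unitVec (fine (nOf i) (MOf i)) μ, ν₀) 1)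
      (B5Blocks16.blockOf (nOf i) (MOf i) (x₀ + unitVec (fine (nOf i) (MOf i)) μ))
      (single_supported (nOf i) (MOf i) _ ν₀) (x, κ)
    rw [Matrix.mulVec_single_one, Pi.norm_single, norm_one, mul_one] at this
    exact this
  have hB : ‖shiftDiff (calG (nOf i) (hn1 i) (MOf i) a ha) μ' (x, κ) (x₀, ν₀)‖ ≤
      C / ((nOf i : ℕ) : ℝ) * E := by
    have := locBound_shiftDiff (nOf i) (MOf i) (hn1 i) a ha (hloc i).2 μ'
      (Pi.single (x₀, ν₀) 1) (B5Blocks16.blockOf (nOf i) (MOf i) x₀)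
      (single_supported (nOf i) (MOf i) x₀ ν₀) (x, κ)
    rw [Matrix.mulVec_single_one, Pi.norm_single, norm_one, mul_one] at this
    exact this
  have h1 : ‖shiftDiff (calG (nOf i) (hn1 i) (MOf i) a ha) μ' (x, κ)
          (x₀ + unitVec (fine (nOf i) (MOf i)) μ, ν₀)
        - shiftDiff (calG (nOf i) (hn1 i) (MOf i) a ha) μ' (x, κ) (x₀, ν₀)‖ ≤
      2 * (C / ((nOf i : ℕ) : ℝ)) * Real.exp δ₀ * E := by
    refine (norm_sub_le _ _).trans ?_
    have eA := exp_block_shift_le (nOf i) (MOf i) hδ₀.le x x₀ μ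
    have e1 : E ≤ Real.exp δ₀ * E :=
      le_mul_of_one_le_left (Real.exp_nonneg _) (Real.one_le_exp hδ₀.le)
    have hCn : 0 ≤ C / ((nOf i : ℕ) : ℝ) := by positivity
    calc _ ≤ C / ((nOf i : ℕ) : ℝ) * (Real.exp δ₀ * E)
          + C / ((nOf i : ℕ) : ℝ) * (Real.exp δ₀ * E) :=
          add_le_add (hA.trans (mul_le_mul_of_nonneg_left eA hCn))
            (hB.trans (mul_le_mul_of_nonneg_left e1 hCn))
      _ = 2 * (C / ((nOf i : ℕ) : ℝ)) * Real.exp δ₀ * E := by ring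
  rw [hlhs, hlhs] at h1
  have h2 := exp_block_le_exp_fine (nOf i) (MOf i) hδ₀.le x x₀
  have rem := remainder_profile (d := d + 2) (by omega) (B := (1 : ℝ)) hδ₀ hn1' zero_le_one hr01
  rw [← hρ, one_mul, one_mul, show d + 2 - 2 = d by omega] at rem
  have hnd : 1 / ((nOf i : ℕ) : ℝ) * Real.exp (-(δ₀ * (tdist x₀ x : ℝ) / ((nOf i : ℕ) : ℝ))) =
      ((nOf i : ℕ) : ℝ) ^ (d + 1) * ((1 / ((nOf i : ℕ) : ℝ)) ^ (d + 2) *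
        Real.exp (-(δ₀ * (tdist x₀ x : ℝ) / ((nOf i : ℕ) : ℝ)))) := by
    rw [pow_succ (1 / ((nOf i : ℕ) : ℝ)) (d + 1), ← mul_assoc, ← mul_assoc, ← mul_pow,
      mul_one_div_cancel hnpos.ne', one_pow, one_mul]
  have hNd : ((nOf i : ℕ) : ℝ) ^ (d + 1) ≤ (N₀ : ℝ) ^ (d + 1) :=
    pow_le_pow_left₀ hnpos.le hN' (d + 1)
  calc _ ≤ 2 * (C / ((nOf i : ℕ) : ℝ)) * Real.exp δ₀ *
          (Real.exp δ₀ * Real.exp (-(δ₀ * (tdist x₀ x : ℝ) / ((nOf i : ℕ) : ℝ)))) :=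
        h1.trans (mul_le_mul_of_nonneg_left h2 (by positivity))
    _ = 2 * C * Real.exp δ₀ * Real.exp δ₀ * (1 / ((nOf i : ℕ) : ℝ) *
          Real.exp (-(δ₀ * (tdist x₀ x : ℝ) / ((nOf i : ℕ) : ℝ)))) := by ring
    _ = 2 * C * Real.exp δ₀ * Real.exp δ₀ * (((nOf i : ℕ) : ℝ) ^ (d + 1) *
          ((1 / ((nOf i : ℕ) : ℝ)) ^ (d + 2) *
            Real.exp (-(δ₀ * (tdist x₀ x : ℝ) / ((nOf i : ℕ) : ℝ))))) := by rw [hnd]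
    _ ≤ 2 * C * Real.exp δ₀ * Real.exp δ₀ * ((N₀ : ℝ) ^ (d + 1) *
          ((1 + (((d + 2 - 2 : ℕ) : ℝ) / (δ₀ / 2)) ^ d) *
          (1 / ((nOf i : ℕ) : ℝ)) ^ 2 * Real.exp (-(δ₀ / 2 / ((nOf i : ℕ) : ℝ)) * (tdist x₀ x : ℝ))
            / nrm (liftZ (x - x₀)) ^ d)) := by
        refine mul_le_mul_of_nonneg_left (mul_le_mul hNd rem (by positivity) (by positivity))
          (by positivity)
    _ = _ := by rw [show d + 2 - 2 = d by omega]; ring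

/-- **THE TWO DIPOLE LEGS, UNIFORM IN THE INSTANCE.**  For `d ≥ 3`, ASSUMING
[B5, (1.110)–(1.114)] for the reading `fam` and [B5, (1.126)–(1.127)] for the reading `kfam` BY
NAME: there are `δ > 0`, `A₂, A₃ ≥ 0` such that for EVERY instance `i` (no side condition) and
every pair of bonds, the source-bond difference obeys the `η² e^{-(δ/n)‖v‖} / nrm^{d-1}` profile
and the mixed difference the `η² e^{-(δ/n)‖v‖} / nrm^{d}` profile, per base point.  The cutoff
radius is chosen inside (`m = ⌊(n-6)/6⌋` for `n ≥ 24`, `R = 12`); `n ≤ 23` is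
`entry_srcDiff_bound_small` / `entry_mixed_bound_small`.  At `d = 4` these are the shapes of
the `d1x` / `d2x` rows of the consumer's table for `‖v‖_∞ = tdist x₀ x`, up to the consumer's
own bookkeeping of which base point carries the shift. [folklore] -/
theorem legs_uniform₂ (hd : 3 ≤ d)
    (h12 : B5.Prop12Printed (fam nOf hn1 MOf a ha))
    (h126 : B5.Kernel126_127Printed (kfam nOf MOf)) :
    ∃ δ A₂ A₃ : ℝ, 0 < δ ∧ 0 ≤ A₂ ∧ 0 ≤ A₃ ∧ ∀ (i : ι)
      (x x₀ : Tor (fine (nOf i) (MOf i))) (κ ν₀ μ : Fin d),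
        ‖calG (nOf i) (hn1 i) (MOf i) a ha (x, κ) (x₀ + unitVec (fine (nOf i) (MOf i)) μ, ν₀)
            - calG (nOf i) (hn1 i) (MOf i) a ha (x, κ) (x₀, ν₀)‖ ≤
            A₂ * (1 / ((nOf i : ℕ) : ℝ)) ^ 2 *
              Real.exp (-(δ / ((nOf i : ℕ) : ℝ)) * (tdist x₀ x : ℝ)) /
                nrm (liftZ (x - x₀)) ^ (d - 1) ∧
        ∀ μ' : Fin d,
          ‖(calG (nOf i) (hn1 i) (MOf i) a ha (x + unitVec (fine (nOf i) (MOf i)) μ', κ)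
                (x₀ + unitVec (fine (nOf i) (MOf i)) μ, ν₀)
              - calG (nOf i) (hn1 i) (MOf i) a ha (x, κ)
                (x₀ + unitVec (fine (nOf i) (MOf i)) μ, ν₀))
            - (calG (nOf i) (hn1 i) (MOf i) a ha (x + unitVec (fine (nOf i) (MOf i)) μ', κ)
                (x₀, ν₀)
              - calG (nOf i) (hn1 i) (MOf i) a ha (x, κ) (x₀, ν₀))‖ ≤
            A₃ * (1 / ((nOf i : ℕ) : ℝ)) ^ 2 *
              Real.exp (-(δ / ((nOf i : ℕ) : ℝ)) * (tdist x₀ x : ℝ)) /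
                nrm (liftZ (x - x₀)) ^ d := by
  obtain ⟨δ₁, A₀, hδ₁, hA₀, hbig₀⟩ :=
    entry_srcDiff_bound nOf hn1 MOf a ha hd (R := 12) (by norm_num) h12 h126
  obtain ⟨δ₂, A₁, hδ₂, hA₁, hbig₁⟩ :=
    entry_mixed_bound nOf hn1 MOf a ha hd (R := 12) (by norm_num) h12 h126
  obtain ⟨δ₃, B₀, hδ₃, hB₀, hs0⟩ := entry_srcDiff_bound_small nOf hn1 MOf a ha hd 23 h12
  obtain ⟨δ₄, B₁, hδ₄, hB₁, hs1⟩ := entry_mixed_bound_small nOf hn1 MOf a ha hd 23 h12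
  refine ⟨min (min δ₁ δ₂) (min δ₃ δ₄), max A₀ B₀, max A₁ B₁,
    lt_min (lt_min hδ₁ hδ₂) (lt_min hδ₃ hδ₄), le_max_of_le_left hA₀, le_max_of_le_left hA₁,
    fun i x x₀ κ ν₀ μ => ?_⟩
  have hnpos : (0 : ℝ) < ((nOf i : ℕ) : ℝ) := Nat.cast_pos.mpr (NeZero.pos _)
  have hr0 : (0 : ℝ) ≤ (tdist x₀ x : ℝ) := Nat.cast_nonneg _
  have hρpos : 0 < nrm (liftZ (x - x₀)) := nrm_pos _
  set δ := min (min δ₁ δ₂) (min δ₃ δ₄) with hδ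
  have mono : ∀ {δ' : ℝ}, δ ≤ δ' →
      Real.exp (-(δ' / ((nOf i : ℕ) : ℝ)) * (tdist x₀ x : ℝ)) ≤
        Real.exp (-(δ / ((nOf i : ℕ) : ℝ)) * (tdist x₀ x : ℝ)) := by
    intro δ' hle
    refine Real.exp_le_exp.mpr ?_
    rw [neg_mul, neg_mul]
    exact neg_le_neg (mul_le_mul_of_nonneg_right (div_le_div_of_nonneg_right hle hnpos.le) hr0)
  have weaken : ∀ {v A A' δ' : ℝ} {k : ℕ}, δ ≤ δ' → 0 ≤ A → A ≤ A' →
      v ≤ A * (1 / ((nOf i : ℕ) : ℝ)) ^ 2 * Real.exp (-(δ' / ((nOf i : ℕ) : ℝ)) * (tdist x₀ x : ℝ))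
        / nrm (liftZ (x - x₀)) ^ k →
      v ≤ A' * (1 / ((nOf i : ℕ) : ℝ)) ^ 2 *
        Real.exp (-(δ / ((nOf i : ℕ) : ℝ)) * (tdist x₀ x : ℝ)) / nrm (liftZ (x - x₀)) ^ k := by
    intro v A A' δ' k hle hA hAA' hv
    refine hv.trans (div_le_div_of_nonneg_right ?_ (by positivity))
    exact mul_le_mul (mul_le_mul_of_nonneg_right hAA' (by positivity)) (mono hle)
      (by positivity) (mul_nonneg (hA.trans hAA') (by positivity))
  have l1 : δ ≤ δ₁ := (min_le_left _ _).trans (min_le_left _ _)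
  have l2 : δ ≤ δ₂ := (min_le_left _ _).trans (min_le_right _ _)
  have l3 : δ ≤ δ₃ := (min_le_right _ _).trans (min_le_left _ _)
  have l4 : δ ≤ δ₄ := (min_le_right _ _).trans (min_le_right _ _)
  by_cases h24 : 24 ≤ nOf i
  · -- large `n`: cutoff radius `m = (n - 6) / 6`
    have har : 1 ≤ (nOf i - 6) / 6 ∧ (nOf i - 6) / 6 ≤ nOf i ∧ nOf i ≤ 12 * ((nOf i - 6) / 6) ∧
        6 * ((nOf i - 6) / 6) + 6 ≤ nOf i := by omega
    have hRm : ((nOf i : ℕ) : ℝ) ≤ 12 * (((nOf i - 6) / 6 : ℕ) : ℝ) := by exact_mod_cast har.2.2.1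
    have hNm : ∀ ν, 6 * ((nOf i - 6) / 6) + 6 ≤ fine (nOf i) (MOf i) ν := fun ν =>
      har.2.2.2.trans (Nat.le_mul_of_pos_right _ (NeZero.pos (MOf i ν)))
    exact ⟨weaken l1 hA₀ (le_max_left _ _)
        (hbig₀ i ((nOf i - 6) / 6) har.1 har.2.1 hRm hNm x x₀ κ ν₀ μ),
      fun μ' => weaken l2 hA₁ (le_max_left _ _)
        (hbig₁ i ((nOf i - 6) / 6) har.1 har.2.1 hRm hNm x x₀ κ ν₀ μ μ')⟩
  · have hN : nOf i ≤ 23 := by omega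
    exact ⟨weaken l3 hB₀ (le_max_right _ _) (hs0 i hN x x₀ κ ν₀ μ),
      fun μ' => weaken l4 hB₁ (le_max_right _ _) (hs1 i hN x x₀ κ ν₀ μ μ')⟩

end SmallDipole

end Literature.MathematicalPhysics.QuantumFieldTheory.Balaban1983to89.Beta.VectorTailsDipole
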